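import Mathlib.Analysis.Calculus.Darboux
import Mathlib.Analysis.Calculus.Deriv.MeanValue
import Mathlib.Analysis.Calculus.FDeriv.OfCompLeft
import Mathlib.Analysis.InnerProductSpace.PiL2
import Mathlib.LinearAlgebra.QuadraticForm.Basic
import Mathlib.Geometry.Manifold.MFDeriv.Atlas
import Mathlib.Geometry.Manifold.VectorBundle.Hom
import Literature.Geometry.Lorentzian.Extension
import HarnessLib

/-!
# The `C⁰`-inextendibility of Minkowski spacetime (Sbierski 2018, Thm. 17)

This file discharges the named fact `Literature.Geometry.Lorentzian.minkowski_isC0Inextendible`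
of `Literature.Geometry.Lorentzian.Extension`:

* `minkowski_isC0Inextendible_holds : minkowski_isC0Inextendible`, i.e. Minkowski spacetime
  `Minkowski.spacetime = (ℝ⁴, η, ∂ₜ)` admits no `C⁰`-extension in the sense of
  `LorentzianManifold.IsExtension` (a smooth isometric open embedding `ι` into a connected
  Lorentzian `4`-manifold `(M', g')` with continuous metric and `ι(ℝ⁴) ≠ M'`).

The proof follows J. Sbierski, *The `C⁰`-inextendibility of the Schwarzschild spacetime and the
spacelike diameter in Lorentzian geometry*, J. Differential Geom. **108** (2018) 319–378
(arXiv:1507.00601), §3, Theorem 17, together with the preparatory Lemma 4 (near-Minkowskian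
charts), Proposition 5 (openness of timelike futures, here only inside one chart) and Lemma 16
(a timelike curve leaving `ι(M)`), all from §2 of the same paper. Everything is proved; no named
fact is consumed.

## Structure of the formal proof

All the analysis happens in `E4 = EuclideanSpace ℝ (Fin 4)`, index `0` being time, with
`η = Minkowski.bilin` and `x̲ = E4.spatial x`.

1. **Chart data** (`C0Extension.ChartData`, `C0Extension.chartDataOf`; Sbierski's Step 1).
   Given an extension `ι : ℝ⁴ → M'`, pick `p ∈ ∂ι(ℝ⁴)` (it exists since `M'` is connected and
   `ι(ℝ⁴)` is open, nonempty and proper) and the extended chart `φ` of `M'` at `p`. In this chart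
   we record: the metric components `G = C0Extension.chartBilin g' p` (continuous on the chart
   image `V` because `g'` is a `C⁰` section of the bundle of bilinear forms — this is where the
   bundle trivialisations are unfolded, `C0Extension.continuousOn_chartBilin` — and Lorentzian),
   the coordinate expression `F = φ ∘ ι` on `W = ι⁻¹(dom φ)` with `F^*G = η` (the isometry
   condition `ι^* g' = η` read in the chart), its open image `Ω` with continuous inverse `H`, the
   boundary point `y₀ = φ p ∈ V̄ ∩ Ω̄ \ Ω`, and two consequences of `ι` being an open embedding
   into a Hausdorff space: `F x → y ∈ V \ Ω` forces `‖x‖ → ∞`, and `W ∩ F⁻¹(K)` is closed for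
   compact `K ⊆ V`.
2. **Lemma 16 in the chart** (`C0Extension.ChartData.exists_exit`): by continuity of `G` there
   are a ball around `y₀` and a cone of directions around a `G(y₀)`-timelike vector `T` which are
   `G`-timelike throughout the ball (this replaces Lemma 4/Prop. 5); walking from a point of `Ω`
   towards a point outside `Ω` along such a direction and taking the first exit parameter
   (`C0Extension.exists_first_exit`, the supremum argument of Lemma 16) gives `ỹ ∈ V \ Ω` and a
   `G`-timelike straight segment `ỹ + t u`, `t ∈ [-s₁, 0)`, inside `Ω`.
3. **Normalisation** (`C0Extension.ChartData.false`): a Sylvester frame `P` of `G(ỹ)` with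
   `P ∂₀ ∝ u` (`C0Extension.exists_frame`, via an orthogonal basis of `u^⊥`,
   `LinearMap.BilinForm.exists_orthogonal_basis`) and the affine change of chart `z ↦ ỹ + P z`
   make `G(0) = η`, `‖G - η‖ ≤ 1/5` on a ball `B_ε` (Lemma 4 with `δ = 1/5`), and the segment the
   time axis `t ∂₀`; its pull-back `γ = H(t ∂₀)` is a timelike curve of Minkowski space (inverse
   function theorem for `H`, `HasFDerivAt.of_local_left_inverse`), unbounded as `t ↑ 0`, and by
   Darboux's theorem either future or past directed; the past case is reduced to the future case
   by the time reversal of Minkowski space (`C0Extension.core_false_past`).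
4. **The core** (`C0Extension.core_false`; Sbierski's Steps 1.2, 1.3, 2, 3). *Step 2.2*
   (`C0Extension.exists_neg_bilin_gt`): the Lorentzian distance `-η(γ s - q, γ s - q)`,
   `q = γ(-s₀)`, is unbounded as `s ↑ 0`. *Steps 1.2–3*: for such an `s`, the straight (maximal)
   Minkowski segment from `q` to `r = γ s` is reached from `γ|[-s₀, s]` through the family of
   segments `[γ t, r]`, `t ↓ -s₀` (Step 2.1); by a continuous induction on `t`
   (`IsClosed.Icc_subset_of_forall_mem_nhdsWithin`) all these segments lie in `W` with images
   in the compact double cone `K ⊆ B_ε` of slope `2` between `-s₀ ∂₀` and `s ∂₀` — closedness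
   from `W ∩ F⁻¹(K)` closed, openness from the tube lemma and the cone estimate
   `C0Extension.segment_image_mem_cones` (Step 1.2: the image of a timelike segment in `B_ε`
   is a `G`-timelike `C¹` curve, future directed by Darboux's theorem and the position of its
   endpoints, hence its increments lie in the cone `‖X̲‖ ≤ 2 X⁰`). Finally (Step 1.3, pointwise:
   `C0Extension.neg_bilin_le_of_segment`) the mean value theorem for the time coordinate of the
   image of `[q, r]` and `-G(X, X) ≤ 2 (X⁰)²` in `B_ε` give `-η(r - q, r - q) ≤ 2 (s + s₀)² < 2 s₀²`,
   contradicting Step 2.2.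

Simplifications with respect to the printed proof: curves are images of straight Minkowski
segments, so no piecewise smooth curves, Lorentzian lengths or timelike homotopies in general
position are needed, and the cones are taken with slope `2` (`‖X̲‖ < 2 |X⁰|` contains all
`G`-causal vectors when `‖G - η‖ ≤ 1/5`) instead of Sbierski's Euclidean angles `5/8`, `5/6`.

## References

* J. Sbierski, *The `C⁰`-inextendibility of the Schwarzschild spacetime and the spacelike
  diameter in Lorentzian geometry*, J. Differential Geom. 108 (2018), 319–378; arXiv:1507.00601,
  §2 (Lemma 4, Prop. 5, Def. 14, Lemma 16) and §3 (Thm. 17).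
* B. O'Neill, *Semi-Riemannian geometry with applications to relativity*, Academic Press 1983,
  Ch. 2, Lemmas 24–26 (orthonormal bases of scalar product spaces).
-/

open Bundle TopologicalSpace Topology Manifold Set Filter Metric Module
open scoped Manifold ContDiff InnerProductSpace

noncomputable section

-- Instance searches on `E4 →L[ℝ] E4 →L[ℝ] ℝ` (model `E4 = PiLp 2 _`) and on the bundles of
-- (bi)linear forms over an abstract manifold are slow at this Mathlib pin.
set_option synthInstance.maxHeartbeats 400000

namespace Literature.Geometry.Lorentzian

namespace C0Extension

local notation "η" => Minkowski.bilin
local notation "sp" => E4.spatial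

/-! ### Algebra of the Minkowski form on `E4` -/

/-- `‖v‖² = (v⁰)² + ‖v̲‖²` on `E4` (Pythagoras for the time/space splitting). [folklore] -/
theorem norm_sq_eq (v : E4) : ‖v‖ ^ 2 = (v 0) ^ 2 + ‖sp v‖ ^ 2 := by
  rw [EuclideanSpace.real_norm_sq_eq, EuclideanSpace.real_norm_sq_eq, Fin.sum_univ_succ]
  simp

/-- `η(v, v) = -(v⁰)² + ‖v̲‖²` (O'Neill 1983, Ch. 5, Ex. 5.1). [folklore] -/
theorem bilin_self_eq (v : E4) : η v v = -(v 0) ^ 2 + ‖sp v‖ ^ 2 := by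
  rw [Minkowski.bilin_apply, EuclideanSpace.real_norm_sq_eq]
  simp [pow_two]

/-- `η(v, v) = ‖v‖² - 2 (v⁰)²`. [folklore] -/
theorem bilin_self_eq' (v : E4) : η v v = ‖v‖ ^ 2 - 2 * (v 0) ^ 2 := by
  rw [bilin_self_eq, norm_sq_eq]; ring

/-- `∂₀` has no spatial part. [folklore] -/
theorem spatial_basisVector_zero : sp (E4.basisVector 0) = 0 := by
  ext i; simp [Fin.succ_ne_zero]

/-- `‖∂₀‖ = 1`. [folklore] -/
theorem norm_basisVector_zero : ‖E4.basisVector 0‖ = 1 := by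
  simp [E4.basisVector]

/-- `(t ∂₀)⁰ = t`. [folklore] -/
theorem smul_basisVector_apply_zero (t : ℝ) : (t • E4.basisVector 0) 0 = t := by simp

/-- `t ∂₀` has no spatial part. [folklore] -/
theorem spatial_smul_basisVector (t : ℝ) : sp (t • E4.basisVector 0) = 0 := by
  rw [map_smul, spatial_basisVector_zero, smul_zero]

/-- `‖t ∂₀‖ = |t|`. [folklore] -/
theorem norm_smul_basisVector (t : ℝ) : ‖t • E4.basisVector 0‖ = |t| := by
  rw [norm_smul, norm_basisVector_zero, mul_one, Real.norm_eq_abs]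

/-- `|v⁰| ≤ ‖v‖`. [folklore] -/
theorem abs_apply_zero_le_norm (v : E4) : |v 0| ≤ ‖v‖ := by
  have h := norm_sq_eq v
  nlinarith [norm_nonneg v, abs_nonneg (v 0), sq_abs (v 0), norm_nonneg (sp v)]

/-- `‖v̲‖ ≤ ‖v‖`. [folklore] -/
theorem norm_spatial_le_norm (v : E4) : ‖sp v‖ ≤ ‖v‖ := by
  have h := norm_sq_eq v
  nlinarith [norm_nonneg v, sq_nonneg (v 0), norm_nonneg (sp v)]

/-- `‖v‖ ≤ |v⁰| + ‖v̲‖`. [folklore] -/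
theorem norm_le_abs_add_norm_spatial (v : E4) : ‖v‖ ≤ |v 0| + ‖sp v‖ := by
  have h := norm_sq_eq v
  nlinarith [norm_nonneg v, abs_nonneg (v 0), sq_abs (v 0), norm_nonneg (sp v)]

/-- `η` is nondegenerate: an `η`-isometric linear map is injective. [folklore] -/
theorem injective_of_isometry {B : E4 →L[ℝ] E4 →L[ℝ] ℝ} {A : E4 →L[ℝ] E4}
    (h : ∀ v w, B (A v) (A w) = η v w) : Function.Injective A := by
  intro v w hvw
  have : ∀ z, η (v - w) z = 0 := fun z ↦ by
    rw [← h, map_sub, hvw, sub_self, map_zero, zero_apply]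
  exact sub_eq_zero.mp (Minkowski.bilin_nondegenerate _ this)

/-! ### Near-Minkowskian bilinear forms -/

/-- `|B(v, w) - η(v, w)| ≤ δ ‖v‖ ‖w‖` when `‖B - η‖ ≤ δ` (operator norm). [folklore] -/
theorem abs_sub_bilin_le {B : E4 →L[ℝ] E4 →L[ℝ] ℝ} {δ : ℝ} (hB : ‖B - η‖ ≤ δ) (v w : E4) :
    |B v w - η v w| ≤ δ * ‖v‖ * ‖w‖ := by
  have h := (B - η).le_opNorm₂ v w
  rw [Real.norm_eq_abs] at h
  calc |B v w - η v w| = |(B - η) v w| := by simp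
    _ ≤ ‖B - η‖ * ‖v‖ * ‖w‖ := h
    _ ≤ δ * ‖v‖ * ‖w‖ := by gcongr

/-- For `‖B - η‖ ≤ 1/5`, every nonzero `B`-causal vector lies in the double cone of slope `2`.
[cite: SbierskiJDG2018, §3, Thm. 17, proof, Step 1.1] -/
theorem norm_spatial_lt_two_mul_abs {B : E4 →L[ℝ] E4 →L[ℝ] ℝ} (hB : ‖B - η‖ ≤ 1 / 5) {X : E4}
    (hX : B X X ≤ 0) (hX0 : X ≠ 0) : ‖sp X‖ < 2 * |X 0| := by
  by_contra hle
  push Not at hle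
  have h1 := abs_sub_bilin_le hB X X
  have h2 := bilin_self_eq X
  have h3 := norm_sq_eq X
  have hpos : 0 < ‖X‖ := norm_pos_iff.mpr hX0
  have h4 : (3 : ℝ) / 5 * ‖X‖ ^ 2 ≤ η X X := by
    rw [h2]
    nlinarith [abs_nonneg (X 0), sq_abs (X 0), norm_nonneg (sp X)]
  have h5 : B X X - η X X ≥ -(1 / 5 * ‖X‖ * ‖X‖) := by
    have := (abs_le.mp h1).1; linarith
  nlinarith

/-- For `‖B - η‖ ≤ 1/5`: `-B(X, X) ≤ 2 (X⁰)²`.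
[cite: SbierskiJDG2018, §3, Thm. 17, proof, Step 1.3] -/
theorem neg_self_le {B : E4 →L[ℝ] E4 →L[ℝ] ℝ} (hB : ‖B - η‖ ≤ 1 / 5) (X : E4) :
    -B X X ≤ 2 * (X 0) ^ 2 := by
  have h1 := abs_sub_bilin_le hB X X
  have h2 := bilin_self_eq X
  have h3 := norm_sq_eq X
  have h5 : B X X - η X X ≥ -(1 / 5 * ‖X‖ * ‖X‖) := by
    have := (abs_le.mp h1).1; linarith
  nlinarith [norm_nonneg (sp X)]

/-- For `‖B - η‖ ≤ 1/5`: `B(∂₀, ∂₀) < 0`. [cite: SbierskiJDG2018, §3, Thm. 17, proof, Step 1.1] -/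
theorem self_basisVector_neg {B : E4 →L[ℝ] E4 →L[ℝ] ℝ} (hB : ‖B - η‖ ≤ 1 / 5) :
    B (E4.basisVector 0) (E4.basisVector 0) < 0 := by
  have h1 := abs_sub_bilin_le hB (E4.basisVector 0) (E4.basisVector 0)
  rw [Minkowski.bilin_basisVector_zero, norm_basisVector_zero] at h1
  have := (abs_le.mp h1).2
  linarith

/-! ### Increments of curves with velocities in a cone -/

/-- A curve `c : ℝ → E4`, continuous on `[a, b]` and differentiable on `(a, b)` with velocities in
the open cone `‖X̲‖ < k X⁰`, has its increment `c b - c a` in that cone (`a < b`).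
[cite: SbierskiJDG2018, §3, Thm. 17, proof, Step 1.2] -/
theorem norm_spatial_sub_lt_of_deriv {c c' : ℝ → E4} {a b k : ℝ} (hab : a < b)
    (hc : ContinuousOn c (Icc a b)) (hd : ∀ u ∈ Ioo a b, HasDerivAt c (c' u) u)
    (hcone : ∀ u ∈ Ioo a b, ‖sp (c' u)‖ < k * c' u 0) :
    ‖sp (c b - c a)‖ < k * (c b 0 - c a 0) := by
  -- for every `w` with `‖w‖ ≤ 1`, `φ_w(u) = k (c u)⁰ - ⟪w, sp (c u)⟫` is strictly increasing
  have key : ∀ w : E3, ‖w‖ ≤ 1 → ⟪w, sp (c b) - sp (c a)⟫_ℝ < k * (c b 0 - c a 0) := by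
    intro w hw
    set φ : ℝ → ℝ := fun u ↦ k * c u 0 - ⟪w, sp (c u)⟫_ℝ with hφ
    have hφ' : ∀ u ∈ Ioo a b, HasDerivAt φ (k * c' u 0 - ⟪w, sp (c' u)⟫_ℝ) u := by
      intro u hu
      have h0 : HasDerivAt (fun u ↦ c u 0) (c' u 0) u := by
        have := ((EuclideanSpace.proj (0 : Fin 4) : E4 →L[ℝ] ℝ).hasFDerivAt.comp_hasDerivAt u
          (hd u hu))
        simpa [Function.comp_def] using this
      have h1 : HasDerivAt (fun u ↦ sp (c u)) (sp (c' u)) u :=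
        E4.spatial.hasFDerivAt.comp_hasDerivAt u (hd u hu)
      have h2 : HasDerivAt (fun u ↦ ⟪w, sp (c u)⟫_ℝ) ⟪w, sp (c' u)⟫_ℝ u := by
        have := ((innerSL ℝ w).hasFDerivAt.comp_hasDerivAt u h1)
        simpa [Function.comp_def] using this
      exact (h0.const_mul k).sub h2
    have hφc : ContinuousOn φ (Icc a b) := by
      have h0 : ContinuousOn (fun u ↦ c u 0) (Icc a b) :=
        ((EuclideanSpace.proj (0 : Fin 4) : E4 →L[ℝ] ℝ).continuous.comp_continuousOn hc)
      have h1 : ContinuousOn (fun u ↦ ⟪w, sp (c u)⟫_ℝ) (Icc a b) :=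
        (innerSL ℝ w).continuous.comp_continuousOn (E4.spatial.continuous.comp_continuousOn hc)
      exact (h0.const_smul k).sub h1 |>.congr fun u _ ↦ by simp [hφ, smul_eq_mul]
    have hmono : StrictMonoOn φ (Icc a b) := by
      refine strictMonoOn_of_deriv_pos (convex_Icc a b) hφc ?_
      intro u hu
      rw [interior_Icc] at hu
      rw [(hφ' u hu).deriv, sub_pos]
      calc ⟪w, sp (c' u)⟫_ℝ ≤ ‖w‖ * ‖sp (c' u)‖ := real_inner_le_norm _ _
        _ ≤ 1 * ‖sp (c' u)‖ := by gcongr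
        _ = ‖sp (c' u)‖ := one_mul _
        _ < k * c' u 0 := hcone u hu
    have hlt := hmono (left_mem_Icc.mpr hab.le) (right_mem_Icc.mpr hab.le) hab
    simp only [hφ] at hlt
    rw [inner_sub_right]
    linarith
  set d : E3 := sp (c b) - sp (c a) with hd_def
  have hd' : sp (c b - c a) = d := by rw [map_sub]
  rw [hd']
  by_cases hd0 : d = 0
  · have := key 0 (by simp)
    rw [inner_zero_left] at this
    simpa [hd0] using this
  · have hdpos : 0 < ‖d‖ := norm_pos_iff.mpr hd0
    have := key (‖d‖⁻¹ • d) (by rw [norm_smul, norm_inv, norm_norm, inv_mul_cancel₀ hdpos.ne'])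
    rwa [real_inner_smul_left, real_inner_self_eq_norm_mul_norm, ← mul_assoc,
      inv_mul_cancel₀ hdpos.ne', one_mul] at this

/-- Closed-cone version of `norm_spatial_sub_lt_of_deriv` for `a ≤ b`.
[cite: SbierskiJDG2018, §3, Thm. 17, proof, Step 1.2] -/
theorem norm_spatial_sub_le_of_deriv {c c' : ℝ → E4} {a b k : ℝ} (hab : a ≤ b)
    (hc : ContinuousOn c (Icc a b)) (hd : ∀ u ∈ Ioo a b, HasDerivAt c (c' u) u)
    (hcone : ∀ u ∈ Ioo a b, ‖sp (c' u)‖ < k * c' u 0) :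
    ‖sp (c b - c a)‖ ≤ k * (c b 0 - c a 0) := by
  rcases hab.eq_or_lt with rfl | hab
  · simp
  · exact (norm_spatial_sub_lt_of_deriv hab hc hd hcone).le

/-! ### Divergence of the Lorentzian distance along an unbounded timelike curve (Step 2.2) -/

/-- **Sbierski 2018, Thm. 17, Step 2.2.** Along a curve `γ` of Minkowski space whose chords are
future-directed timelike and which is unbounded as `t ↑ 0`, the Lorentzian distance from
`γ(-s₀)` is unbounded: `-η(γ t - γ(-s₀), γ t - γ(-s₀)) → ∞`.
[cite: SbierskiJDG2018, §3, Thm. 17, proof, Step 2.2] -/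
theorem exists_neg_bilin_gt {γ : ℝ → E4} {s₀ : ℝ} (hs₀ : 0 < s₀)
    (hchord : ∀ t₁ t₂, -s₀ ≤ t₁ → t₁ < t₂ → t₂ < 0 → ‖sp (γ t₂ - γ t₁)‖ < γ t₂ 0 - γ t₁ 0)
    (hinf : Tendsto (fun t ↦ ‖γ t‖) (𝓝[<] 0) atTop) (C : ℝ) :
    ∃ s ∈ Ioo (-s₀) 0, C < -η (γ s - γ (-s₀)) (γ s - γ (-s₀)) := by
  set t₁ : ℝ := -s₀ / 2 with ht₁
  have ht₁' : -s₀ < t₁ := by rw [ht₁]; linarith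
  have ht₁0 : t₁ < 0 := by rw [ht₁]; linarith
  set w : E4 := γ t₁ - γ (-s₀) with hw
  have hw' : ‖sp w‖ < w 0 := by
    have := hchord (-s₀) t₁ le_rfl ht₁' ht₁0
    simpa [hw] using this
  set κ : ℝ := w 0 - ‖sp w‖ with hκ
  have hκpos : 0 < κ := by rw [hκ]; linarith
  -- choose `s` close to `0` with `‖γ s‖` large
  have hev1 : ∀ᶠ t in 𝓝[<] (0 : ℝ), ‖γ t₁‖ + 2 * (|C| + 1) / κ < ‖γ t‖ :=
    hinf.eventually (eventually_gt_atTop _)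
  have hev2 : ∀ᶠ t in 𝓝[<] (0 : ℝ), t₁ < t ∧ t < 0 := by
    have : Ioo t₁ 0 ∈ 𝓝[<] (0 : ℝ) := Ioo_mem_nhdsLT ht₁0
    filter_upwards [this] with t ht using ht
  obtain ⟨s, hs1, hs2, hs3⟩ := (hev1.and hev2).exists
  refine ⟨s, ⟨by linarith, hs3⟩, ?_⟩
  set z : E4 := γ s - γ t₁ with hz
  have hz' : ‖sp z‖ < z 0 := by
    have := hchord t₁ s ht₁'.le hs2 hs3
    simpa [hz] using this
  have hz0 : ‖z‖ < 2 * z 0 := by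
    have h1 := norm_le_abs_add_norm_spatial z
    have h2 : 0 < z 0 := lt_of_le_of_lt (norm_nonneg _) hz'
    rw [abs_of_pos h2] at h1
    linarith
  have hzbig : 2 * (|C| + 1) / κ < ‖z‖ := by
    have : ‖γ s‖ - ‖γ t₁‖ ≤ ‖z‖ := by
      rw [hz]; exact norm_sub_norm_le _ _ |>.trans (le_of_eq (by rw [norm_sub_rev]))
    linarith
  have hv : γ s - γ (-s₀) = w + z := by rw [hw, hz]; abel
  rw [hv, bilin_self_eq]
  have hsp : ‖sp (w + z)‖ ≤ ‖sp w‖ + ‖sp z‖ := by rw [map_add]; exact norm_add_le _ _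
  have hw0 : 0 < w 0 := lt_of_le_of_lt (norm_nonneg _) hw'
  have hz00 : 0 < z 0 := lt_of_le_of_lt (norm_nonneg _) hz'
  have hadd : (w + z) 0 = w 0 + z 0 := rfl
  rw [hadd]
  -- -η ≥ ((w0+z0) - (‖sp w‖+‖sp z‖)) * ((w0+z0) + (‖sp w‖ + ‖sp z‖)) ≥ κ * z0
  have h1 : κ * z 0 ≤ (w 0 + z 0) ^ 2 - (‖sp w‖ + ‖sp z‖) ^ 2 := by
    have hA : κ ≤ (w 0 + z 0) - (‖sp w‖ + ‖sp z‖) := by rw [hκ]; linarith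
    have hB : z 0 ≤ (w 0 + z 0) + (‖sp w‖ + ‖sp z‖) := by
      linarith [norm_nonneg (sp w), norm_nonneg (sp z)]
    nlinarith [hκpos.le, hz00.le]
  have h2 : (‖sp (w + z)‖) ^ 2 ≤ (‖sp w‖ + ‖sp z‖) ^ 2 := by
    gcongr
  have h3 : |C| + 1 < κ * z 0 := by
    have h4 : (|C| + 1) / κ < z 0 := by
      have e : 2 * (|C| + 1) / κ = 2 * ((|C| + 1) / κ) := by ring
      linarith [hzbig.trans hz0]
    have := (div_lt_iff₀ hκpos).mp h4
    linarith
  linarith [le_abs_self C]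


/-! ### Images of Minkowski segments in a near-Minkowskian chart (Steps 1.2–1.3) -/

section Segment

variable {W : Set E4} {F : E4 → E4} {F' : E4 → E4 →L[ℝ] E4} {G : E4 → E4 →L[ℝ] E4 →L[ℝ] ℝ}
  {ε : ℝ}

/-- Derivative of `u ↦ F (p + u • d)`. [folklore] -/
theorem hasDerivAt_comp_lineMap (hF : ∀ x ∈ W, HasFDerivAt F (F' x) x) {p d : E4} {u : ℝ}
    (hu : p + u • d ∈ W) :
    HasDerivAt (fun u : ℝ ↦ F (p + u • d)) (F' (p + u • d) d) u := by
  have h1 : HasDerivAt (fun u : ℝ ↦ p + u • d) d u := by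
    simpa using ((hasDerivAt_id u).smul_const d).const_add p
  exact (hF _ hu).comp_hasDerivAt u h1

/-- Derivative of the time coordinate of `u ↦ F (p + u • d)`. [folklore] -/
theorem hasDerivAt_comp_lineMap_zero (hF : ∀ x ∈ W, HasFDerivAt F (F' x) x) {p d : E4} {u : ℝ}
    (hu : p + u • d ∈ W) :
    HasDerivAt (fun u : ℝ ↦ F (p + u • d) 0) (F' (p + u • d) d 0) u := by
  have := ((EuclideanSpace.proj (0 : Fin 4) : E4 →L[ℝ] ℝ).hasFDerivAt.comp_hasDerivAt u
    (hasDerivAt_comp_lineMap hF hu))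
  simpa [Function.comp_def] using this

/-- **Sbierski 2018, Thm. 17, Step 1.2** for the image of a timelike Minkowski segment
`u ↦ p + u d`, `u ∈ [0, 1]`, under the isometric coordinate map `F` into a near-Minkowskian
chart: if the image lies in the chart ball and ends later than it starts, then it is a
future-directed timelike curve of the chart, hence stays in the cones of slope `2` issuing from
its endpoints. [cite: SbierskiJDG2018, §3, Thm. 17, proof, Step 1.2] -/
theorem segment_image_mem_cones (hF : ∀ x ∈ W, HasFDerivAt F (F' x) x)
    (hiso : ∀ x ∈ W, ∀ v w, G (F x) (F' x v) (F' x w) = η v w)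
    (hG : ∀ y ∈ ball (0 : E4) ε, ‖G y - η‖ ≤ 1 / 5) {p d : E4} (hd : η d d < 0)
    (hseg : ∀ u ∈ Icc (0 : ℝ) 1, p + u • d ∈ W ∧ F (p + u • d) ∈ ball (0 : E4) ε)
    (htime : F p 0 < F (p + d) 0) {u : ℝ} (hu : u ∈ Icc (0 : ℝ) 1) :
    ‖sp (F (p + u • d) - F p)‖ ≤ 2 * (F (p + u • d) 0 - F p 0) ∧
      ‖sp (F (p + d) - F (p + u • d))‖ ≤ 2 * (F (p + d) 0 - F (p + u • d) 0) := by
  set c : ℝ → E4 := fun u ↦ F (p + u • d) with hc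
  set c' : ℝ → E4 := fun u ↦ F' (p + u • d) d with hc'
  have hderiv : ∀ u ∈ Icc (0 : ℝ) 1, HasDerivAt c (c' u) u := fun u hu ↦
    hasDerivAt_comp_lineMap hF (hseg u hu).1
  have hderiv0 : ∀ u ∈ Icc (0 : ℝ) 1, HasDerivAt (fun u ↦ c u 0) (c' u 0) u := fun u hu ↦
    hasDerivAt_comp_lineMap_zero hF (hseg u hu).1
  have hcont : ContinuousOn c (Icc 0 1) := fun u hu ↦ (hderiv u hu).continuousAt.continuousWithinAt
  have hd0 : d ≠ 0 := by
    rintro rfl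
    simp at hd
  -- the velocities are `G`-timelike, hence in the double cone of slope 2
  have hcone : ∀ u ∈ Icc (0 : ℝ) 1, ‖sp (c' u)‖ < 2 * |c' u 0| := by
    intro u hu
    have hx := (hseg u hu).1
    refine norm_spatial_lt_two_mul_abs (hG _ (hseg u hu).2) ?_ ?_
    · rw [hc', hiso _ hx]
      exact hd.le
    · exact fun h0 ↦ hd0 (injective_of_isometry (hiso _ hx) (by
        change c' u = _
        rw [h0, map_zero]))
  have hne : ∀ u ∈ Icc (0 : ℝ) 1, c' u 0 ≠ 0 := by
    intro u hu h0
    have := hcone u hu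
    rw [h0, abs_zero, mul_zero] at this
    exact absurd this (not_lt.mpr (norm_nonneg _))
  -- by Darboux, the time components of the velocities have constant sign, positive by `htime`
  have hpos : ∀ u ∈ Icc (0 : ℝ) 1, 0 < c' u 0 := by
    rcases hasDerivWithinAt_forall_lt_or_forall_gt_of_forall_ne (convex_Icc 0 1)
      (fun u hu ↦ (hderiv0 u hu).hasDerivWithinAt) hne with hlt | hgt
    · exfalso
      obtain ⟨u₀, hu₀, hslope⟩ := exists_hasDerivAt_eq_slope (fun u ↦ c u 0) (fun u ↦ c' u 0)
        zero_lt_one (fun u hu ↦ (hderiv0 u hu).continuousAt.continuousWithinAt)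
        (fun u hu ↦ hderiv0 u (Ioo_subset_Icc_self hu))
      have h1 := hlt u₀ (Ioo_subset_Icc_self hu₀)
      rw [hslope] at h1
      have h2 : c 0 0 < c 1 0 := by simpa [hc] using htime
      have : (c 1 0 - c 0 0) / (1 - 0) > 0 := by rw [sub_zero, div_one]; linarith
      linarith
    · exact hgt
  have hcone' : ∀ u ∈ Icc (0 : ℝ) 1, ‖sp (c' u)‖ < 2 * c' u 0 := fun u hu ↦ by
    rw [← abs_of_pos (hpos u hu)]; exact hcone u hu
  have hc0 : c 0 = F p := by simp [hc]
  have hc1 : c 1 = F (p + d) := by simp [hc]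
  constructor
  · have := norm_spatial_sub_le_of_deriv (k := 2) hu.1 (hcont.mono (Icc_subset_Icc_right hu.2))
      (fun v hv ↦ hderiv v ⟨hv.1.le, hv.2.le.trans hu.2⟩)
      (fun v hv ↦ hcone' v ⟨hv.1.le, hv.2.le.trans hu.2⟩)
    rwa [hc0] at this
  · have := norm_spatial_sub_le_of_deriv (k := 2) hu.2 (hcont.mono (Icc_subset_Icc_left hu.1))
      (fun v hv ↦ hderiv v ⟨hu.1.trans hv.1.le, hv.2.le⟩)
      (fun v hv ↦ hcone' v ⟨hu.1.trans hv.1.le, hv.2.le⟩)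
    rwa [hc1] at this

/-- **Sbierski 2018, Thm. 17, Step 1.3**, pointwise form: for the image of a Minkowski segment
in the chart ball there is a parameter at which `-η(d, d) ≤ 2 (F(p + d)⁰ - F(p)⁰)²`
(mean value theorem for the time coordinate and the bound `-G(X, X) ≤ 2 (X⁰)²`).
[cite: SbierskiJDG2018, §3, Thm. 17, proof, Step 1.3] -/
theorem neg_bilin_le_of_segment (hF : ∀ x ∈ W, HasFDerivAt F (F' x) x)
    (hiso : ∀ x ∈ W, ∀ v w, G (F x) (F' x v) (F' x w) = η v w)
    (hG : ∀ y ∈ ball (0 : E4) ε, ‖G y - η‖ ≤ 1 / 5) {p d : E4}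
    (hseg : ∀ u ∈ Icc (0 : ℝ) 1, p + u • d ∈ W ∧ F (p + u • d) ∈ ball (0 : E4) ε) :
    -η d d ≤ 2 * (F (p + d) 0 - F p 0) ^ 2 := by
  obtain ⟨u₀, hu₀, hslope⟩ := exists_hasDerivAt_eq_slope (fun u ↦ F (p + u • d) 0)
    (fun u ↦ F' (p + u • d) d 0) zero_lt_one
    (fun u hu ↦ (hasDerivAt_comp_lineMap_zero hF (hseg u hu).1).continuousAt.continuousWithinAt)
    (fun u hu ↦ hasDerivAt_comp_lineMap_zero hF (hseg u (Ioo_subset_Icc_self hu)).1)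
  simp only [sub_zero, div_one, zero_smul, add_zero, one_smul] at hslope
  have hx := (hseg u₀ (Ioo_subset_Icc_self hu₀)).1
  have h1 := neg_self_le (hG _ (hseg u₀ (Ioo_subset_Icc_self hu₀)).2) (F' (p + u₀ • d) d)
  rw [hiso _ hx, hslope] at h1
  exact h1

end Segment

/-! ### The core contradiction (Steps 2 and 3) -/

/-- Closed double cone (slope `2`) between two points of the time axis: compact. [folklore] -/
theorem isCompact_cone_inter {a b : ℝ} :
    IsCompact {y : E4 | ‖sp (y - a • E4.basisVector 0)‖ ≤ 2 * (y 0 - a) ∧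
      ‖sp (b • E4.basisVector 0 - y)‖ ≤ 2 * (b - y 0)} := by
  have hc0 : Continuous fun y : E4 ↦ y 0 := by
    simpa using (EuclideanSpace.proj (0 : Fin 4) : E4 →L[ℝ] ℝ).continuous
  refine Metric.isCompact_of_isClosed_isBounded ?_ ?_
  · simp only [Set.setOf_and]
    refine IsClosed.inter ?_ ?_
    · exact isClosed_le (by fun_prop) (by fun_prop)
    · exact isClosed_le (by fun_prop) (by fun_prop)
  · refine (Metric.isBounded_closedBall (x := (0 : E4)) (r := |a| + |b| + 2 * (b - a))).subset ?_
    rintro y ⟨h1, h2⟩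
    rw [mem_closedBall, dist_zero_right]
    have hsp : sp (y - a • E4.basisVector 0) = sp y := by
      rw [map_sub, spatial_smul_basisVector, sub_zero]
    rw [hsp] at h1
    have h3 := norm_le_abs_add_norm_spatial y
    have h4 : a ≤ y 0 := by linarith [norm_nonneg (sp y)]
    have h5 : y 0 ≤ b := by linarith [norm_nonneg (sp (b • E4.basisVector 0 - y))]
    have h6 : |y 0| ≤ |a| + |b| := by
      rcases le_or_gt 0 (y 0) with h | h
      · rw [abs_of_nonneg h]; linarith [le_abs_self b, abs_nonneg a]
      · rw [abs_of_neg h]; linarith [neg_le_abs a, abs_nonneg b]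
    linarith

/-- **Sbierski 2018, Thm. 17 (core of the proof, Steps 1.2–3)** for normalised chart data: there
is no isometric `C¹` map `F` from an open set `W` of Minkowski space into a near-Minkowskian chart
ball `B_ε` (`‖G - η‖ ≤ 1/5`) carrying a future-directed timelike curve `γ` of Minkowski space,
unbounded as `t ↑ 0`, onto the axis segment `t ↦ t ∂₀`, `t ∈ [-s₀, 0)`, `3 s₀ < ε`, with
`W ∩ F⁻¹(K)` closed for compact `K ⊆ B_ε`. (The Lorentzian distance from `γ(-s₀)` to `γ(s)`
diverges as `s ↑ 0`, Step 2.2; the maximising segment from `γ(-s₀)` to `γ(s)` is reached from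
`γ` through the segments `[γ t, γ s]`, `t ↓ -s₀`, whose images cannot leave the compact double
cone `K` between `-s₀ ∂₀` and `s ∂₀`, Steps 1.2 and 3; but images of segments in `B_ε` have
Lorentzian length `< √2 s₀`, Step 1.3.) [cite: SbierskiJDG2018, §3, Thm. 17, proof, Steps 2–3] -/
theorem core_false {W : Set E4} {F : E4 → E4} {F' : E4 → E4 →L[ℝ] E4}
    {G : E4 → E4 →L[ℝ] E4 →L[ℝ] ℝ} {ε s₀ : ℝ} {γ γ' : ℝ → E4} (hW : IsOpen W)
    (hF : ∀ x ∈ W, HasFDerivAt F (F' x) x)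
    (hiso : ∀ x ∈ W, ∀ v w, G (F x) (F' x v) (F' x w) = η v w)
    (hG : ∀ y ∈ ball (0 : E4) ε, ‖G y - η‖ ≤ 1 / 5) (hs₀ : 0 < s₀) (hs₀ε : 3 * s₀ < ε)
    (hγW : ∀ t ∈ Ico (-s₀) 0, γ t ∈ W)
    (hγF : ∀ t ∈ Ico (-s₀) 0, F (γ t) = t • E4.basisVector 0)
    (hγc : ContinuousOn γ (Ico (-s₀) 0))
    (hγ' : ∀ t ∈ Ioo (-s₀) 0, HasDerivAt γ (γ' t) t ∧ ‖sp (γ' t)‖ < γ' t 0)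
    (hinf : Tendsto (fun t ↦ ‖γ t‖) (𝓝[<] 0) atTop)
    (hclosed : ∀ K ⊆ ball (0 : E4) ε, IsCompact K → IsClosed (W ∩ F ⁻¹' K)) : False := by
  -- chords of `γ` are future-directed timelike
  have hchord : ∀ t₁ t₂, -s₀ ≤ t₁ → t₁ < t₂ → t₂ < 0 →
      ‖sp (γ t₂ - γ t₁)‖ < γ t₂ 0 - γ t₁ 0 := by
    intro t₁ t₂ h1 h12 h2
    have := norm_spatial_sub_lt_of_deriv (k := 1) h12
      (hγc.mono (Icc_subset_Ico_iff h12.le |>.mpr ⟨h1, h2⟩))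
      (fun u hu ↦ (hγ' u ⟨lt_of_le_of_lt h1 hu.1, hu.2.trans h2⟩).1)
      (fun u hu ↦ by simpa using (hγ' u ⟨lt_of_le_of_lt h1 hu.1, hu.2.trans h2⟩).2)
    simpa using this
  -- Step 2.2: a point `r = γ s` at Lorentzian distance `> √2 s₀` from `q = γ (-s₀)`
  obtain ⟨s, ⟨hs1, hs2⟩, hC⟩ := exists_neg_bilin_gt hs₀ hchord hinf (2 * s₀ ^ 2)
  set q : E4 := γ (-s₀) with hq
  set r : E4 := γ s with hr
  have hqW : q ∈ W := hγW _ ⟨le_rfl, by linarith⟩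
  have hrW : r ∈ W := hγW _ ⟨hs1.le, hs2⟩
  have hFq : F q = (-s₀) • E4.basisVector 0 := hγF _ ⟨le_rfl, by linarith⟩
  have hFr : F r = s • E4.basisVector 0 := hγF _ ⟨hs1.le, hs2⟩
  -- the compact double cone `K` between `F q` and `F r`, inside the chart ball
  set K : Set E4 := {y | ‖sp (y - (-s₀) • E4.basisVector 0)‖ ≤ 2 * (y 0 - (-s₀)) ∧
    ‖sp (s • E4.basisVector 0 - y)‖ ≤ 2 * (s - y 0)} with hK
  have hKc : IsCompact K := isCompact_cone_inter
  have hKball : K ⊆ ball (0 : E4) ε := by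
    rintro y ⟨h1, h2⟩
    rw [mem_ball, dist_zero_right]
    have hsp : sp (y - (-s₀) • E4.basisVector 0) = sp y := by
      rw [map_sub, spatial_smul_basisVector, sub_zero]
    rw [hsp] at h1
    have h3 := norm_le_abs_add_norm_spatial y
    have h4 : -s₀ ≤ y 0 := by linarith [norm_nonneg (sp y)]
    have h5 : y 0 ≤ s := by linarith [norm_nonneg (sp (s • E4.basisVector 0 - y))]
    have h6 : |y 0| ≤ s₀ := abs_le.mpr ⟨h4, by linarith⟩
    linarith
  have hWK : IsClosed (W ∩ F ⁻¹' K) := hclosed K hKball hKc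
  -- membership in `K` from the two cone estimates of `segment_image_mem_cones`
  have memK : ∀ {t' : ℝ} {y : E4}, -s₀ < t' →
      ‖sp (y - t' • E4.basisVector 0)‖ ≤ 2 * (y 0 - (t' • E4.basisVector 0) 0) →
      ‖sp (s • E4.basisVector 0 - y)‖ ≤ 2 * ((s • E4.basisVector 0) 0 - y 0) → y ∈ K := by
    intro t' y ht' h1 h2
    rw [smul_basisVector_apply_zero] at h1 h2
    refine ⟨?_, h2⟩
    have e1 : sp (y - (-s₀) • E4.basisVector 0) = sp (y - t' • E4.basisVector 0) := by
      rw [map_sub, map_sub, spatial_smul_basisVector, spatial_smul_basisVector]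
    rw [e1]
    linarith
  -- the family of paths: `γ` up to `γ t`, then the straight segment from `γ t` to `r`
  set Φ : ℝ → ℝ → E4 := fun t u ↦ γ t + u • (r - γ t) with hΦ
  set S : Set ℝ := {θ | ∀ u ∈ Icc (0 : ℝ) 1, Φ (s - θ) u ∈ W ∩ F ⁻¹' K} with hS
  have hb : 0 < s + s₀ := by linarith
  -- continuity of the paths in the family parameter
  have hΦc : ∀ u : ℝ, ContinuousOn (fun θ ↦ Φ (s - θ) u) (Icc 0 (s + s₀)) := by
    intro u
    have hγθ : ContinuousOn (fun θ ↦ γ (s - θ)) (Icc 0 (s + s₀)) := by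
      refine hγc.comp (by fun_prop) ?_
      intro θ hθ
      exact ⟨by linarith [hθ.2], by linarith [hθ.1]⟩
    simp only [hΦ]
    exact hγθ.add ((continuousOn_const.sub hγθ).const_smul u)
  have hScl : IsClosed (S ∩ Icc 0 (s + s₀)) := by
    have : S ∩ Icc 0 (s + s₀) =
        ⋂ u ∈ Icc (0 : ℝ) 1, (Icc 0 (s + s₀) ∩ (fun θ ↦ Φ (s - θ) u) ⁻¹' (W ∩ F ⁻¹' K)) := by
      ext θ
      simp only [hS, mem_inter_iff, mem_setOf_eq, mem_iInter, mem_preimage]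
      constructor
      · rintro ⟨h1, h2⟩ u hu
        exact ⟨h2, h1 u hu⟩
      · intro h
        exact ⟨fun u hu ↦ (h u hu).2, (h 0 (left_mem_Icc.mpr zero_le_one)).1⟩
    rw [this]
    exact isClosed_biInter fun u _ ↦ (hΦc u).preimage_isClosed_of_isClosed isClosed_Icc hWK
  have h0S : (0 : ℝ) ∈ S := by
    intro u hu
    have hΦ0 : Φ (s - 0) u = r := by simp [hΦ, hr]
    rw [hΦ0]
    refine ⟨hrW, ?_⟩
    rw [mem_preimage, hFr]
    refine memK hs1 ?_ ?_ <;> simp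
  -- the inductive step: openness of `W ∩ F⁻¹(B_ε)` and the cone estimate
  have hFc : ContinuousOn F W := fun x hx ↦ (hF x hx).continuousAt.continuousWithinAt
  have hO : IsOpen (W ∩ F ⁻¹' ball (0 : E4) ε) := hFc.isOpen_inter_preimage hW isOpen_ball
  have hstep : ∀ θ ∈ S ∩ Ico 0 (s + s₀), S ∈ 𝓝[>] θ := by
    rintro θ ⟨hθS, hθ0, hθb⟩
    set t : ℝ := s - θ with ht
    have ht1 : -s₀ < t := by rw [ht]; linarith
    have ht2 : t < 0 := by rw [ht]; linarith
    -- tube lemma around the compact path `Φ t ([0, 1])`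
    have hΨ : ∀ u : ℝ, ContinuousAt (fun z : ℝ × ℝ ↦ Φ z.1 z.2) (t, u) := by
      intro u
      have hγt : ContinuousAt γ t := hγc.continuousAt (Ico_mem_nhds ht1 ht2)
      have h1 : ContinuousAt (fun z : ℝ × ℝ ↦ γ z.1) (t, u) :=
        hγt.comp_of_eq continuousAt_fst rfl
      simp only [hΦ]
      exact h1.add (continuousAt_snd.smul (continuousAt_const.sub h1))
    have hev : ∀ᶠ t' in 𝓝 t, ∀ u ∈ Icc (0 : ℝ) 1, Φ t' u ∈ W ∩ F ⁻¹' ball (0 : E4) ε := by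
      refine isCompact_Icc.eventually_forall_of_forall_eventually fun u hu ↦ ?_
      have hmem : Φ t u ∈ W ∩ F ⁻¹' ball (0 : E4) ε :=
        ⟨(hθS u hu).1, hKball (hθS u hu).2⟩
      exact (hΨ u).preimage_mem_nhds (hO.mem_nhds hmem)
    have hev' : ∀ᶠ θ' in 𝓝 θ, ∀ u ∈ Icc (0 : ℝ) 1, Φ (s - θ') u ∈ W ∩ F ⁻¹' ball (0 : E4) ε := by
      have hcts : Tendsto (fun θ' : ℝ ↦ s - θ') (𝓝 θ) (𝓝 t) := by
        rw [ht]; exact (continuous_const.sub continuous_id).continuousAt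
      exact hcts.eventually hev
    have hev2 : ∀ᶠ θ' in 𝓝[>] θ, θ' ∈ Ioo θ (s + s₀) := Ioo_mem_nhdsGT hθb
    filter_upwards [nhdsWithin_le_nhds hev', hev2] with θ' h1 h2
    intro u hu
    set t' : ℝ := s - θ' with ht'
    have ht'1 : -s₀ < t' := by rw [ht']; linarith [h2.2]
    have ht'2 : t' < s := by rw [ht']; linarith [h2.1]
    refine ⟨(h1 u hu).1, ?_⟩
    rw [mem_preimage]
    -- apply the cone estimate to the segment from `γ t'` to `r`
    have hd : η (r - γ t') (r - γ t') < 0 := by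
      have hch := hchord t' s ht'1.le ht'2 hs2
      rw [bilin_self_eq]
      have h0 : 0 ≤ ‖sp (r - γ t')‖ := norm_nonneg _
      have : (γ s - γ t') 0 = r 0 - γ t' 0 := rfl
      nlinarith
    have hseg : ∀ v ∈ Icc (0 : ℝ) 1, γ t' + v • (r - γ t') ∈ W ∧
        F (γ t' + v • (r - γ t')) ∈ ball (0 : E4) ε := fun v hv ↦ h1 v hv
    have hFt' : F (γ t') = t' • E4.basisVector 0 := hγF t' ⟨ht'1.le, by linarith⟩
    have hpr : γ t' + (r - γ t') = r := by abel
    have htime : F (γ t') 0 < F (γ t' + (r - γ t')) 0 := by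
      rw [hpr, hFt', hFr, smul_basisVector_apply_zero, smul_basisVector_apply_zero]
      exact ht'2
    have hc := segment_image_mem_cones hF hiso hG hd hseg htime hu
    rw [hpr, hFt', hFr] at hc
    exact memK ht'1 hc.1 hc.2
  -- conclusion of the continuous induction: the straight segment from `q` to `r` is mapped into `K`
  have hall := hScl.Icc_subset_of_forall_mem_nhdsWithin h0S hstep
  have hend : s + s₀ ∈ S := hall (right_mem_Icc.mpr hb.le)
  have hseg : ∀ u ∈ Icc (0 : ℝ) 1, q + u • (r - q) ∈ W ∧ F (q + u • (r - q)) ∈ ball (0 : E4) ε := by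
    intro u hu
    have h := hend u hu
    have e : s - (s + s₀) = -s₀ := by ring
    simp only [hΦ, e] at h
    exact ⟨h.1, hKball h.2⟩
  -- Step 3: the image of the segment is too short
  have hle := neg_bilin_le_of_segment hF hiso hG hseg
  have hpr : q + (r - q) = r := by abel
  rw [hpr, hFr, hFq, smul_basisVector_apply_zero, smul_basisVector_apply_zero] at hle
  have : (s - -s₀) ^ 2 < s₀ ^ 2 := by nlinarith
  linarith


/-! ### Sylvester normal form with prescribed timelike leg -/

/-- `η` on the standard basis vectors of `E4`. [folklore] -/
theorem bilin_single_single (μ ν : Fin 4) :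
    η (EuclideanSpace.single μ (1 : ℝ)) (EuclideanSpace.single ν (1 : ℝ)) =
      if μ = ν then (if μ = 0 then -1 else 1) else 0 := by
  rw [Minkowski.bilin_apply]
  refine Fin.cases ?_ (fun i ↦ ?_) μ <;> refine Fin.cases ?_ (fun j ↦ ?_) ν
  · simp [Fin.succ_ne_zero]
  · simp [Fin.succ_ne_zero, (Fin.succ_ne_zero j).symm]
  · simp [Fin.succ_ne_zero, (Fin.succ_ne_zero i).symm]
  · by_cases hij : i = j
    · subst hij
      simp [Fin.succ_ne_zero, Finset.sum_ite_eq']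
    · have : i.succ ≠ j.succ := fun h ↦ hij (Fin.succ_inj.mp h)
      have hji : j ≠ i := Ne.symm hij
      simp [Fin.succ_ne_zero, this, hji, Finset.sum_ite_eq', Fin.succ_inj]

/-- **Sylvester normal form with prescribed timelike leg.** A symmetric bilinear form `B` on `E4`
with a `B`-timelike vector `u` (`B(u,u) < 0`) and positive definite on the `B`-orthogonal
complement of any timelike vector is `η` in a suitable linear frame `P` with `P ∂₀ = c u`,
`c = (-B(u,u))^{-1/2}` (O'Neill 1983, Ch. 2, Lemma 24 ff.; here via an orthogonal basis of
`u^⊥`). [cite: ONeillSemiRiemannian1983, Ch. 2, Lemma 24] -/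
theorem exists_frame {B : E4 →L[ℝ] E4 →L[ℝ] ℝ} (hsymm : ∀ v w, B v w = B w v)
    (hpos : ∀ v w, B v v < 0 → B v w = 0 → w ≠ 0 → 0 < B w w) {u : E4} (hu : B u u < 0) :
    ∃ (P : E4 ≃L[ℝ] E4) (c : ℝ), 0 < c ∧ P (E4.basisVector 0) = c • u ∧
      ∀ v w, B (P v) (P w) = η v w := by
  -- the unit timelike vector `T = c u`
  set c : ℝ := (Real.sqrt (-B u u))⁻¹ with hc
  have hsqrt : 0 < Real.sqrt (-B u u) := Real.sqrt_pos.mpr (by linarith)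
  have hcpos : 0 < c := inv_pos.mpr hsqrt
  set T : E4 := c • u with hT
  have hTT : B T T = -1 := by
    rw [hT, map_smul, map_smul, FunLike.coe_smul, Pi.smul_apply, smul_eq_mul, smul_eq_mul, hc]
    have h2 : Real.sqrt (-B u u) ^ 2 = -B u u := Real.sq_sqrt (by linarith)
    field_simp
    nlinarith [h2]
  have hTneg : B T T < 0 := by rw [hTT]; norm_num
  -- the orthogonal complement `S = T^⊥` and the restricted (positive definite) form
  set ℓ : E4 →ₗ[ℝ] ℝ := (B T : E4 →L[ℝ] ℝ).toLinearMap with hℓ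
  set S : Submodule ℝ E4 := LinearMap.ker ℓ with hS
  have hℓT : ℓ T = -1 := hTT
  have hmemS : ∀ {w : E4}, w ∈ S ↔ B T w = 0 := fun {w} ↦ by rw [hS, LinearMap.mem_ker]; rfl
  set Bs : LinearMap.BilinForm ℝ S := LinearMap.BilinForm.restrict B.toLinearMap₁₂ S with hBs
  have hBs_apply : ∀ x y : S, Bs x y = B x y := fun x y ↦ rfl
  have hBs_symm : Bs.IsSymm := ⟨fun x y ↦ by rw [hBs_apply, hBs_apply, hsymm]⟩
  -- `S` has dimension 3
  have hfin : finrank ℝ S = 3 := by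
    have h1 := ℓ.finrank_range_add_finrank_ker
    have hsurj : Function.Surjective ℓ := fun r ↦ ⟨(-r) • T, by
      rw [map_smul, hℓT, smul_eq_mul]; ring⟩
    rw [LinearMap.range_eq_top.mpr hsurj, finrank_top, Module.finrank_self,
      finrank_euclideanSpace_fin] at h1
    rw [← hS] at h1
    omega
  -- an orthogonal basis of `S`, with positive `B`-squares
  obtain ⟨b, hb⟩ := LinearMap.BilinForm.exists_orthogonal_basis
    (LinearMap.BilinForm.isSymm_iff.mp hBs_symm)
  have hbpos : ∀ i, 0 < B (b i) (b i) := by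
    intro i
    refine hpos T (b i) hTneg ((hmemS).mp (b i).2) ?_
    exact fun h0 ↦ b.ne_zero i (Subtype.ext h0)
  have hborth : ∀ i j, i ≠ j → B (b i) (b j) = 0 := fun i j hij ↦ by
    have := LinearMap.isOrthoᵢ_def.1 hb i j hij
    rwa [hBs_apply] at this
  -- the frame `f = (T, b₁/|b₁|, b₂/|b₂|, b₃/|b₃|)`
  set e : Fin 3 → Fin (finrank ℝ S) := Fin.cast hfin.symm with he
  have he_inj : Function.Injective e := Fin.cast_injective _
  set n : Fin 3 → ℝ := fun i ↦ (Real.sqrt (B (b (e i)) (b (e i))))⁻¹ with hn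
  have hn2 : ∀ i, n i ^ 2 * B (b (e i)) (b (e i)) = 1 := by
    intro i
    rw [hn, inv_pow, Real.sq_sqrt (hbpos _).le, inv_mul_cancel₀ (hbpos _).ne']
  set f : Fin 4 → E4 := Fin.cons T (fun i ↦ n i • (b (e i) : E4)) with hf
  have hf0 : f 0 = T := rfl
  have hfs : ∀ i : Fin 3, f i.succ = n i • (b (e i) : E4) := fun i ↦ rfl
  -- its Gram matrix is that of `η`
  have hmat : ∀ μ ν, B (f μ) (f ν) =
      η (EuclideanSpace.single μ (1 : ℝ)) (EuclideanSpace.single ν (1 : ℝ)) := by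
    intro μ ν
    rw [bilin_single_single]
    refine Fin.cases ?_ (fun i ↦ ?_) μ <;> refine Fin.cases ?_ (fun j ↦ ?_) ν
    · simp [hf0, hTT]
    · simp only [hf0, hfs, map_smul, smul_eq_mul, if_false, (Fin.succ_ne_zero j).symm]
      rw [(hmemS).mp (b (e j)).2, mul_zero]
    · simp only [hf0, hfs, map_smul, smul_eq_mul, FunLike.coe_smul, Pi.smul_apply,
        Fin.succ_ne_zero, if_false]
      rw [hsymm, (hmemS).mp (b (e i)).2, mul_zero]
    · simp only [hfs, map_smul, smul_eq_mul, FunLike.coe_smul, Pi.smul_apply, Fin.succ_inj,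
        Fin.succ_ne_zero, if_false]
      by_cases hij : i = j
      · subst hij
        simp only [if_true]
        rw [← hn2 i]; ring
      · rw [if_neg hij, hborth _ _ (fun h ↦ hij (he_inj h)), mul_zero, mul_zero]
  -- hence `f` is a basis
  have hli : LinearIndependent ℝ f := by
    refine LinearMap.linearIndependent_of_isOrthoᵢ (B := B.toLinearMap₁₂) (v := f) ?_ ?_
    · intro μ ν hμν
      show B (f μ) (f ν) = 0
      rw [hmat, bilin_single_single, if_neg hμν]
    · intro μ
      show B (f μ) (f μ) ≠ 0
      rw [hmat, bilin_single_single, if_pos rfl]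
      split_ifs <;> norm_num
  set fb : Basis (Fin 4) ℝ E4 := basisOfLinearIndependentOfCardEqFinrank hli
    (by simp) with hfb
  have hfb_apply : ∀ μ, fb μ = f μ := fun μ ↦ by
    rw [hfb, coe_basisOfLinearIndependentOfCardEqFinrank]
  set P₀ : E4 ≃ₗ[ℝ] E4 := (EuclideanSpace.basisFun (Fin 4) ℝ).toBasis.equiv fb (Equiv.refl _)
    with hP₀
  have hP₀_single : ∀ μ, P₀ (EuclideanSpace.single μ 1) = f μ := by
    intro μ
    rw [← hfb_apply, hP₀, ← EuclideanSpace.basisFun_apply, ← OrthonormalBasis.coe_toBasis,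
      Basis.equiv_apply, Equiv.refl_apply]
  refine ⟨P₀.toContinuousLinearEquiv, c, hcpos, ?_, ?_⟩
  · show P₀ (EuclideanSpace.single 0 1) = c • u
    rw [hP₀_single, hf0, hT]
  · -- two bilinear forms agreeing on a basis
    have key : (B.toLinearMap₁₂).compl₁₂ P₀.toLinearMap P₀.toLinearMap = (η).toLinearMap₁₂ := by
      refine LinearMap.ext_basis (EuclideanSpace.basisFun (Fin 4) ℝ).toBasis
        (EuclideanSpace.basisFun (Fin 4) ℝ).toBasis fun μ ν ↦ ?_
      simp only [LinearMap.compl₁₂_apply, OrthonormalBasis.coe_toBasis,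
        EuclideanSpace.basisFun_apply, LinearEquiv.coe_coe]
      rw [hP₀_single, hP₀_single]
      exact hmat μ ν
    intro v w
    have := LinearMap.congr_fun₂ key v w
    simpa [LinearMap.compl₁₂_apply] using this


/-! ### The metric of the extension in a chart (bundle trivialisations unfolded) -/

section ChartPlumbing

-- `TangentSpace I x` is definitionally the model space (as in Mathlib's `Riemannian.Basic`).
set_option backward.isDefEq.respectTransparency false

variable {E : Type*} [NormedAddCommGroup E] [NormedSpace ℝ E] {H : Type*} [TopologicalSpace H]
  {I : ModelWithCorners ℝ E H} {M : Type*} [TopologicalSpace M] [ChartedSpace H M]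
  [IsManifold I ∞ M]

/-- The preferred trivialisation of the bundle of covectors at `x₀` reads, over the chart domain of
`x₀`, `φ ↦ φ ∘ S_x` with `S_x` the inverse tangent trivialisation (Mathlib's `inCoordinates`,
unfolded). [folklore] -/
theorem dual_trivializationAt_continuousLinearMapAt_apply {x₀ x : M}
    (hx : x ∈ (chartAt H x₀).source) (φ : TangentSpace I x →L[ℝ] ℝ) (w : E) :
    (trivializationAt (E →L[ℝ] ℝ) (fun q : M ↦ TangentSpace I q →L[ℝ] ℝ) x₀).continuousLinearMapAt
      ℝ x φ w = φ ((trivializationAt E (TangentSpace I) x₀).symmL ℝ x w) := by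
  have h := Trivialization.continuousLinearMapAt_apply_of_mem (R := ℝ)
    (trivializationAt (E →L[ℝ] ℝ) (fun q : M ↦ TangentSpace I q →L[ℝ] ℝ) x₀)
    (b := x) (by simpa using hx) φ
  rw [hom_trivializationAt_apply] at h
  rw [h]
  simp only [ContinuousLinearMap.inCoordinates, ContinuousLinearMap.coe_comp,
    Function.comp_apply, Bundle.Trivial.fiberBundle_trivializationAt',
    Bundle.Trivial.continuousLinearMapAt_trivialization, ContinuousLinearMap.coe_id', id_eq]

/-- The preferred trivialisation of the bundle of bilinear forms at `x₀` (in which metrics are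
sections) reads, over the chart domain of `x₀`, `B ↦ B(S_x ·, S_x ·)` with `S_x` the inverse tangent
trivialisation (Mathlib's `inCoordinates`, unfolded twice). [folklore] -/
theorem bilin_trivializationAt_snd_apply {x₀ x : M} (hx : x ∈ (chartAt H x₀).source)
    (B : TangentSpace I x →L[ℝ] TangentSpace I x →L[ℝ] ℝ) (v w : E) :
    (trivializationAt (E →L[ℝ] E →L[ℝ] ℝ)
      (fun q : M ↦ TangentSpace I q →L[ℝ] TangentSpace I q →L[ℝ] ℝ) x₀ ⟨x, B⟩).2 v w =
    B ((trivializationAt E (TangentSpace I) x₀).symmL ℝ x v)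
      ((trivializationAt E (TangentSpace I) x₀).symmL ℝ x w) := by
  rw [hom_trivializationAt_apply]
  simp only [ContinuousLinearMap.inCoordinates, ContinuousLinearMap.coe_comp,
    Function.comp_apply]
  rw [dual_trivializationAt_continuousLinearMapAt_apply hx]

/-- The coordinate expression, in the extended chart at `x₀`, of a family of bilinear forms on
the tangent spaces: `y ↦ ((v, w) ↦ g_{e⁻¹ y}(S v, S w))`, `S` the inverse tangent trivialisation.
[folklore] -/
def chartBilin (g : Π x : M, TangentSpace I x →L[ℝ] TangentSpace I x →L[ℝ] ℝ) (x₀ : M) (y : E) :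
    E →L[ℝ] E →L[ℝ] ℝ :=
  (ContinuousLinearMap.precomp ℝ
      ((trivializationAt E (TangentSpace I) x₀).symmL ℝ ((extChartAt I x₀).symm y))).comp
    ((g ((extChartAt I x₀).symm y)).comp
      ((trivializationAt E (TangentSpace I) x₀).symmL ℝ ((extChartAt I x₀).symm y)))

/-- Unfolding lemma for `chartBilin`. [folklore] -/
theorem chartBilin_apply (g : Π x : M, TangentSpace I x →L[ℝ] TangentSpace I x →L[ℝ] ℝ)
    (x₀ : M) (y : E) (v w : E) :
    chartBilin g x₀ y v w = g ((extChartAt I x₀).symm y)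
      ((trivializationAt E (TangentSpace I) x₀).symmL ℝ ((extChartAt I x₀).symm y) v)
      ((trivializationAt E (TangentSpace I) x₀).symmL ℝ ((extChartAt I x₀).symm y) w) :=
  rfl

/-- `chartBilin g x₀ (φ x) (v, w) = g_x (S_x v, S_x w)` for `x` in the chart domain (`φ` the
extended chart at `x₀`). [folklore] -/
theorem chartBilin_apply_of_mem (g : Π x : M, TangentSpace I x →L[ℝ] TangentSpace I x →L[ℝ] ℝ)
    {x₀ x : M} (hx : x ∈ (chartAt H x₀).source) (v w : E) :
    chartBilin g x₀ (extChartAt I x₀ x) v w = g x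
      ((trivializationAt E (TangentSpace I) x₀).symmL ℝ x v)
      ((trivializationAt E (TangentSpace I) x₀).symmL ℝ x w) := by
  rw [chartBilin_apply, (extChartAt I x₀).left_inv (by simpa using hx)]

/-- The inverse tangent trivialisation at `x₀` inverts the differential of the extended chart at
`x₀` (Mathlib's `TangentBundle.continuousLinearMapAt_trivializationAt`). [folklore] -/
theorem symmL_mfderiv_extChartAt {x₀ x : M} (hx : x ∈ (chartAt H x₀).source)
    (v : TangentSpace I x) :
    (trivializationAt E (TangentSpace I) x₀).symmL ℝ x
      (mfderiv I 𝓘(ℝ, E) (extChartAt I x₀) x v) = v := by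
  have h := (trivializationAt E (TangentSpace I) x₀).symmL_continuousLinearMapAt (R := ℝ)
    (b := x) (by simpa using hx) v
  rw [TangentBundle.continuousLinearMapAt_trivializationAt hx] at h
  exact h

/-- `chartBilin g x₀ (φ x) (dφ v, dφ w) = g_x (v, w)`: the coordinate expression of `g` evaluated on
coordinate expressions of tangent vectors gives back `g`. [folklore] -/
theorem chartBilin_apply_mfderiv (g : Π x : M, TangentSpace I x →L[ℝ] TangentSpace I x →L[ℝ] ℝ)
    {x₀ x : M} (hx : x ∈ (chartAt H x₀).source) (v w : TangentSpace I x) :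
    chartBilin g x₀ (extChartAt I x₀ x) (mfderiv I 𝓘(ℝ, E) (extChartAt I x₀) x v)
      (mfderiv I 𝓘(ℝ, E) (extChartAt I x₀) x w) = g x v w := by
  rw [chartBilin_apply_of_mem g hx, symmL_mfderiv_extChartAt hx, symmL_mfderiv_extChartAt hx]

set_option maxHeartbeats 1000000 in
/-- A `C⁰` section of the bundle of bilinear forms has continuous coordinate expression.
[folklore] -/
theorem continuousOn_chartBilin {g : Π x : M, TangentSpace I x →L[ℝ] TangentSpace I x →L[ℝ] ℝ}
    (hg : ContMDiff I (I.prod 𝓘(ℝ, E →L[ℝ] E →L[ℝ] ℝ)) 0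
      (fun b ↦ TotalSpace.mk' (E →L[ℝ] E →L[ℝ] ℝ)
        (E := fun q : M ↦ TangentSpace I q →L[ℝ] TangentSpace I q →L[ℝ] ℝ) b (g b)))
    (x₀ : M) : ContinuousOn (chartBilin g x₀) (extChartAt I x₀).target := by
  have h1 := (Trivialization.contMDiffOn_section_baseSet_iff (IB := I) (n := 0)
    (trivializationAt (E →L[ℝ] E →L[ℝ] ℝ)
      (fun q : M ↦ TangentSpace I q →L[ℝ] TangentSpace I q →L[ℝ] ℝ) x₀)).mp hg.contMDiffOn
  rw [contMDiffOn_zero_iff] at h1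
  replace h1 := h1.mono (show (chartAt H x₀).source ⊆ _ from fun x hx ↦ by simpa using hx)
  have h2 : ContinuousOn (extChartAt I x₀).symm (extChartAt I x₀).target :=
    continuousOn_extChartAt_symm x₀
  have h3 : MapsTo (extChartAt I x₀).symm (extChartAt I x₀).target (chartAt H x₀).source := by
    intro y hy
    simpa using (extChartAt I x₀).map_target hy
  refine (h1.comp h2 h3).congr ?_
  intro y hy
  ext v w
  simp only [Function.comp_apply]
  rw [bilin_trivializationAt_snd_apply (h3 hy)]
  rfl


/-! ### Chart data of a hypothetical `C⁰`-extension of Minkowski space -/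

/-- Technical gadget: the analytic data, in one chart of the extension, extracted from a
hypothetical `C⁰`-extension `ι : ℝ⁴ → M'` of Minkowski space near a boundary point of `ι(ℝ⁴)`
(Sbierski 2018, proof of Thm. 17, Step 1): the chart image `V`, the metric components `G`
(continuous, Lorentzian), the coordinate expression `F = φ ∘ ι` of `ι` on `W = ι⁻¹(dom φ)`, its
image `Ω = φ(ι(ℝ⁴) ∩ dom φ)`, a continuous inverse `H` of `F` on `Ω`, a boundary point `y₀`, and
the two properness properties of `F` inherited from `ι` being an open embedding into a Hausdorff
space. Only used to derive `False` (`ChartData.false`).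
[cite: SbierskiJDG2018, §3, Thm. 17, proof, Step 1] -/
structure ChartData where
  /-- domain of the coordinate expression of `ι` -/
  W : Set E4
  /-- coordinate expression `φ ∘ ι` of the embedding -/
  F : E4 → E4
  /-- metric components in the chart -/
  G : E4 → E4 →L[ℝ] E4 →L[ℝ] ℝ
  /-- chart image -/
  V : Set E4
  /-- image of `W` -/
  Ω : Set E4
  /-- the boundary point -/
  y₀ : E4
  /-- continuous inverse of `F` on `Ω` -/
  H : E4 → E4
  isOpen_W : IsOpen W
  isOpen_V : IsOpen V
  isOpen_Ω : IsOpen Ω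
  Ω_subset : Ω ⊆ V
  contDiffOn : ContDiffOn ℝ 1 F W
  mapsTo : MapsTo F W Ω
  isometry : ∀ x ∈ W, ∀ v w, G (F x) (fderiv ℝ F x v) (fderiv ℝ F x w) = Minkowski.bilin v w
  continuousOn_G : ContinuousOn G V
  symm_G : ∀ y ∈ V, ∀ v w, G y v w = G y w v
  exists_neg : ∀ y ∈ V, ∃ v, G y v v < 0
  pos_of_orthogonal : ∀ y ∈ V, ∀ v w, G y v v < 0 → G y v w = 0 → w ≠ 0 → 0 < G y w w
  mem_V : y₀ ∈ V
  notMem_Ω : y₀ ∉ Ω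
  mem_closure : y₀ ∈ closure Ω
  proper : ∀ y ∈ V, y ∉ Ω → ∀ R : ℝ, ∃ N ∈ 𝓝 y, ∀ x ∈ W, F x ∈ N → R < ‖x‖
  isClosed_preimage : ∀ K ⊆ V, IsCompact K → IsClosed (W ∩ F ⁻¹' K)
  continuousOn_H : ContinuousOn H Ω
  left_inv : ∀ x ∈ W, H (F x) = x
  right_inv : ∀ y ∈ Ω, F (H y) = y
  H_mem : ∀ y ∈ Ω, H y ∈ W

section Extract

variable {𝓜' : LorentzianManifold.{0} 4 0} {ι : E4 → 𝓜'.carrier}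

/-- A proper nonempty open subset of a connected space has a boundary point outside it.
[cite: SbierskiJDG2018, §2.3, Def. 14 (footnote) and Lemma 16] -/
theorem exists_mem_closure_notMem
    (hι : Minkowski.spacetime.toLorentzianManifold.IsExtension 𝓜' ι) :
    ∃ p : 𝓜'.carrier, p ∈ closure (range ι) ∧ p ∉ range ι := by
  by_contra h
  push Not at h
  have hcl : IsClosed (range ι) := by
    refine isClosed_of_closure_subset fun p hp ↦ h p hp
  have hclopen : IsClopen (range ι) := ⟨hcl, hι.isOpenEmbedding.isOpen_range⟩
  rcases isClopen_iff.mp hclopen with h0 | h1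
  · exact (range_nonempty ι).ne_empty h0
  · exact hι.range_ne_univ h1

variable (ι) in
/-- The chart data at a boundary point `p` of `ι(ℝ⁴)`.
[cite: SbierskiJDG2018, §3, Thm. 17, proof, Step 1] -/
def chartDataOf (hι : Minkowski.spacetime.toLorentzianManifold.IsExtension 𝓜' ι)
    (p : 𝓜'.carrier) (hp : p ∈ closure (range ι)) (hp' : p ∉ range ι) : ChartData where
  W := ι ⁻¹' (chartAt E4 p).source
  F x := extChartAt (𝓡 4) p (ι x)
  G := chartBilin 𝓜'.metric.val p
  V := (extChartAt (𝓡 4) p).target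
  Ω := (extChartAt (𝓡 4) p).target ∩ (extChartAt (𝓡 4) p).symm ⁻¹' range ι
  y₀ := extChartAt (𝓡 4) p p
  H y := (hι.isOpenEmbedding.toOpenPartialHomeomorph ι).symm ((extChartAt (𝓡 4) p).symm y)
  isOpen_W := (chartAt E4 p).open_source.preimage hι.isOpenEmbedding.continuous
  isOpen_V := isOpen_extChartAt_target p
  isOpen_Ω := (continuousOn_extChartAt_symm p).isOpen_inter_preimage (isOpen_extChartAt_target p)
    hι.isOpenEmbedding.isOpen_range
  Ω_subset := inter_subset_left
  contDiffOn := by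
    have h1 : ContMDiffOn (𝓡 4) 𝓘(ℝ, E4) ∞ (fun x ↦ extChartAt (𝓡 4) p (ι x))
        (ι ⁻¹' (chartAt E4 p).source) :=
      (contMDiffOn_extChartAt (n := ∞)).comp hι.contMDiff.contMDiffOn fun x hx ↦ hx
    exact (contMDiffOn_iff_contDiffOn.mp h1).of_le (by norm_num)
  mapsTo := by
    intro x hx
    refine ⟨(extChartAt (𝓡 4) p).map_source (by simpa using hx), ?_⟩
    show (extChartAt (𝓡 4) p).symm (extChartAt (𝓡 4) p (ι x)) ∈ range ι
    rw [(extChartAt (𝓡 4) p).left_inv (by simpa using hx)]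
    exact mem_range_self x
  isometry := by
    intro x hx v w
    have hdι : MDifferentiableAt (𝓡 4) (𝓡 4) ι x := hι.contMDiff.mdifferentiableAt (by simp)
    have hde : MDifferentiableAt (𝓡 4) 𝓘(ℝ, E4) (extChartAt (𝓡 4) p) (ι x) :=
      mdifferentiableAt_extChartAt hx
    have hF : fderiv ℝ (fun x ↦ extChartAt (𝓡 4) p (ι x)) x =
        (mfderiv (𝓡 4) 𝓘(ℝ, E4) (extChartAt (𝓡 4) p) (ι x)).comp (mfderiv (𝓡 4) (𝓡 4) ι x) := by
      rw [← mfderiv_eq_fderiv]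
      exact mfderiv_comp x hde hdι
    have h2 : 𝓜'.metric.val (ι x) (mfderiv (𝓡 4) (𝓡 4) ι x v) (mfderiv (𝓡 4) (𝓡 4) ι x w) =
        Minkowski.bilin v w :=
      congrArg (fun B ↦ B v w) (hι.pullbackBilin_eq x)
    rw [← h2, hF]
    exact chartBilin_apply_mfderiv _ hx _ _
  continuousOn_G := continuousOn_chartBilin 𝓜'.metric.contMDiff p
  symm_G := by
    intro y hy v w
    simp only [chartBilin_apply]
    exact 𝓜'.metric.symm _ _ _
  exists_neg := by
    intro y hy
    have hxs : (extChartAt (𝓡 4) p).symm y ∈ (chartAt E4 p).source := by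
      rw [← extChartAt_source (I := 𝓡 4)]
      exact (extChartAt (𝓡 4) p).map_target hy
    obtain ⟨u, hu⟩ := 𝓜'.metric.exists_timelike ((extChartAt (𝓡 4) p).symm y)
    refine ⟨(trivializationAt E4 (TangentSpace (𝓡 4)) p).continuousLinearMapAt ℝ _ u, ?_⟩
    rw [chartBilin_apply, Trivialization.symmL_continuousLinearMapAt _ (by simpa using hxs)]
    exact hu
  pos_of_orthogonal := by
    intro y hy v w hv hvw hw
    have hxs : (extChartAt (𝓡 4) p).symm y ∈ (chartAt E4 p).source := by
      rw [← extChartAt_source (I := 𝓡 4)]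
      exact (extChartAt (𝓡 4) p).map_target hy
    rw [chartBilin_apply] at hv hvw ⊢
    refine 𝓜'.metric.pos_of_orthogonal _ _ _ hv hvw fun h0 ↦ hw ?_
    have := congrArg ((trivializationAt E4 (TangentSpace (𝓡 4)) p).continuousLinearMapAt ℝ _) h0
    rwa [Trivialization.continuousLinearMapAt_symmL _ (by simpa using hxs), map_zero] at this
  mem_V := mem_extChartAt_target p
  notMem_Ω := by
    rintro ⟨-, h⟩
    exact hp' (by simpa using h)
  mem_closure := by
    rw [mem_closure_iff_nhds]
    intro N hN
    have h1 : (extChartAt (𝓡 4) p) ⁻¹' N ∈ 𝓝 p := (continuousAt_extChartAt p).preimage_mem_nhds hN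
    have h2 : (chartAt E4 p).source ∈ 𝓝 p := (chartAt E4 p).open_source.mem_nhds (mem_chart_source E4 p)
    obtain ⟨q, ⟨hq1, hq2⟩, x, rfl⟩ := mem_closure_iff_nhds.mp hp _ (inter_mem h1 h2)
    refine ⟨extChartAt (𝓡 4) p (ι x), hq1, (extChartAt (𝓡 4) p).map_source (by simpa using hq2), ?_⟩
    show (extChartAt (𝓡 4) p).symm (extChartAt (𝓡 4) p (ι x)) ∈ range ι
    rw [(extChartAt (𝓡 4) p).left_inv (by simpa using hq2)]
    exact mem_range_self x
  proper := by
    intro y hy hyΩ R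
    set q := (extChartAt (𝓡 4) p).symm y with hq
    have hK : IsCompact (ι '' Metric.closedBall (0 : E4) R) :=
      (isCompact_closedBall 0 R).image hι.isOpenEmbedding.continuous
    have hqK : q ∉ ι '' Metric.closedBall (0 : E4) R := by
      rintro ⟨x, -, hx⟩
      exact hyΩ ⟨hy, ⟨x, hx⟩⟩
    have hN : (ι '' Metric.closedBall (0 : E4) R)ᶜ ∈ 𝓝 q := hK.isClosed.isOpen_compl.mem_nhds hqK
    refine ⟨(extChartAt (𝓡 4) p).symm ⁻¹' (ι '' Metric.closedBall (0 : E4) R)ᶜ,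
      (continuousAt_extChartAt_symm'' hy).preimage_mem_nhds hN, fun x hx hxN ↦ ?_⟩
    have : ι x ∉ ι '' Metric.closedBall (0 : E4) R := by
      have h := hxN
      simp only [mem_preimage] at h
      rwa [(extChartAt (𝓡 4) p).left_inv (by simpa using hx)] at h
    by_contra hR
    exact this ⟨x, by simpa using not_lt.mp hR, rfl⟩
  isClosed_preimage := by
    intro K hKV hK
    have hK' : IsCompact ((extChartAt (𝓡 4) p).symm '' K) :=
      hK.image_of_continuousOn ((continuousOn_extChartAt_symm p).mono hKV)
    have heq : ι ⁻¹' (chartAt E4 p).source ∩ (fun x ↦ extChartAt (𝓡 4) p (ι x)) ⁻¹' K =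
        ι ⁻¹' ((extChartAt (𝓡 4) p).symm '' K) := by
      ext x
      simp only [mem_inter_iff, mem_preimage, mem_image]
      constructor
      · rintro ⟨hx, hxK⟩
        exact ⟨_, hxK, (extChartAt (𝓡 4) p).left_inv (by simpa using hx)⟩
      · rintro ⟨k, hk, hkx⟩
        have hks : (extChartAt (𝓡 4) p).symm k ∈ (chartAt E4 p).source := by
          simpa using (extChartAt (𝓡 4) p).map_target (hKV hk)
        refine ⟨by rw [← hkx]; exact hks, ?_⟩
        rw [← hkx, (extChartAt (𝓡 4) p).right_inv (hKV hk)]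
        exact hk
    rw [heq]
    exact hK'.isClosed.preimage hι.isOpenEmbedding.continuous
  continuousOn_H := by
    refine (hι.isOpenEmbedding.toOpenPartialHomeomorph ι).continuousOn_symm.comp
      ((continuousOn_extChartAt_symm p).mono inter_subset_left) ?_
    intro y hy
    rw [IsOpenEmbedding.toOpenPartialHomeomorph_target]
    exact hy.2
  left_inv := by
    intro x hx
    rw [(extChartAt (𝓡 4) p).left_inv (by simpa using hx)]
    exact hι.isOpenEmbedding.toOpenPartialHomeomorph_left_inv ι
  right_inv := by
    intro y hy
    rw [hι.isOpenEmbedding.toOpenPartialHomeomorph_right_inv ι hy.2]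
    exact (extChartAt (𝓡 4) p).right_inv hy.1
  H_mem := by
    intro y hy
    rw [mem_preimage, hι.isOpenEmbedding.toOpenPartialHomeomorph_right_inv ι hy.2]
    simpa using (extChartAt (𝓡 4) p).map_target hy.1

end Extract


end ChartPlumbing

/-! ### Time reversal of Minkowski space and the past-directed case of the core -/

/-- Time reversal `(x⁰, x̲) ↦ (-x⁰, x̲)` of `E4` as a continuous linear map. [folklore] -/
def timeReflectCLM : E4 →L[ℝ] E4 :=
  ContinuousLinearMap.id ℝ E4 -
    (2 : ℝ) • ((EuclideanSpace.proj (0 : Fin 4) : E4 →L[ℝ] ℝ).smulRight (E4.basisVector 0))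

/-- Unfolding lemma for `timeReflectCLM`. [folklore] -/
theorem timeReflectCLM_apply (v : E4) :
    timeReflectCLM v = v - (2 * v 0) • E4.basisVector 0 := by
  simp [timeReflectCLM, mul_smul]

/-- Time reversal negates the time coordinate. [folklore] -/
@[simp] theorem timeReflectCLM_apply_zero (v : E4) : timeReflectCLM v 0 = -v 0 := by
  rw [timeReflectCLM_apply]
  simp; ring

/-- Time reversal preserves the spatial part. [folklore] -/
@[simp] theorem spatial_timeReflectCLM (v : E4) : sp (timeReflectCLM v) = sp v := by
  rw [timeReflectCLM_apply, map_sub, spatial_smul_basisVector, sub_zero]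

/-- Time reversal is an involution. [folklore] -/
theorem timeReflectCLM_timeReflectCLM (v : E4) : timeReflectCLM (timeReflectCLM v) = v := by
  rw [← E4.ofTimeSpace_time_spatial (timeReflectCLM (timeReflectCLM v)),
    ← E4.ofTimeSpace_time_spatial v]
  simp only [E4.time_apply, timeReflectCLM_apply_zero, neg_neg, spatial_timeReflectCLM]
  simp

/-- Time reversal of `E4` as a continuous linear equivalence (an involutive `η`-isometry).
[folklore] -/
def timeReflect : E4 ≃L[ℝ] E4 :=
  ContinuousLinearEquiv.equivOfInverse timeReflectCLM timeReflectCLM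
    timeReflectCLM_timeReflectCLM timeReflectCLM_timeReflectCLM

/-- Unfolding lemma for `timeReflect`. [folklore] -/
@[simp] theorem timeReflect_apply (v : E4) : timeReflect v = timeReflectCLM v := rfl

/-- Time reversal is a Euclidean isometry of `E4`. [folklore] -/
@[simp] theorem norm_timeReflectCLM (v : E4) : ‖timeReflectCLM v‖ = ‖v‖ := by
  have h1 := norm_sq_eq (timeReflectCLM v)
  rw [timeReflectCLM_apply_zero, spatial_timeReflectCLM, neg_sq, ← norm_sq_eq] at h1
  exact (pow_left_inj₀ (norm_nonneg _) (norm_nonneg _) two_ne_zero).mp h1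

/-- Time reversal is an `η`-isometry. [folklore] -/
@[simp] theorem bilin_timeReflectCLM (v w : E4) :
    η (timeReflectCLM v) (timeReflectCLM w) = η v w := by
  rw [Minkowski.bilin_apply, Minkowski.bilin_apply, timeReflectCLM_apply_zero,
    timeReflectCLM_apply_zero, neg_mul_neg]
  congr 1
  refine Finset.sum_congr rfl fun i _ ↦ ?_
  have hv := congrArg (fun z : E3 ↦ z i) (spatial_timeReflectCLM v)
  have hw := congrArg (fun z : E3 ↦ z i) (spatial_timeReflectCLM w)
  simp only [E4.spatial_apply] at hv hw
  rw [hv, hw]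

/-- The core contradiction for a *past*-directed curve `γ`, reduced to `core_false` by time
reversal of Minkowski space (Sbierski 2018, Thm. 17, Step 1: "without loss of generality `γ` is
future directed"). [cite: SbierskiJDG2018, §3, Thm. 17, proof, Step 1] -/
theorem core_false_past {W : Set E4} {F : E4 → E4} {F' : E4 → E4 →L[ℝ] E4}
    {G : E4 → E4 →L[ℝ] E4 →L[ℝ] ℝ} {ε s₀ : ℝ} {γ γ' : ℝ → E4} (hW : IsOpen W)
    (hF : ∀ x ∈ W, HasFDerivAt F (F' x) x)
    (hiso : ∀ x ∈ W, ∀ v w, G (F x) (F' x v) (F' x w) = η v w)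
    (hG : ∀ y ∈ ball (0 : E4) ε, ‖G y - η‖ ≤ 1 / 5) (hs₀ : 0 < s₀) (hs₀ε : 3 * s₀ < ε)
    (hγW : ∀ t ∈ Ico (-s₀) 0, γ t ∈ W)
    (hγF : ∀ t ∈ Ico (-s₀) 0, F (γ t) = t • E4.basisVector 0)
    (hγc : ContinuousOn γ (Ico (-s₀) 0))
    (hγ' : ∀ t ∈ Ioo (-s₀) 0, HasDerivAt γ (γ' t) t ∧ ‖sp (γ' t)‖ < -γ' t 0)
    (hinf : Tendsto (fun t ↦ ‖γ t‖) (𝓝[<] 0) atTop)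
    (hclosed : ∀ K ⊆ ball (0 : E4) ε, IsCompact K → IsClosed (W ∩ F ⁻¹' K)) : False := by
  set R : E4 →L[ℝ] E4 := timeReflectCLM with hR
  refine core_false (W := R ⁻¹' W) (F := F ∘ R) (F' := fun x ↦ (F' (R x)).comp R) (G := G)
    (γ := fun t ↦ R (γ t)) (γ' := fun t ↦ R (γ' t)) (hW.preimage R.continuous) ?_ ?_ hG hs₀ hs₀ε
    ?_ ?_ ?_ ?_ ?_ ?_
  · intro x hx
    exact (hF (R x) hx).comp x R.hasFDerivAt
  · intro x hx v w
    simp only [Function.comp_apply, ContinuousLinearMap.coe_comp, hR]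
    rw [hiso _ hx, bilin_timeReflectCLM]
  · intro t ht
    show R (R (γ t)) ∈ W
    rw [hR, timeReflectCLM_timeReflectCLM]; exact hγW t ht
  · intro t ht
    show F (R (R (γ t))) = _
    rw [hR, timeReflectCLM_timeReflectCLM]; exact hγF t ht
  · exact R.continuous.comp_continuousOn hγc
  · intro t ht
    refine ⟨R.hasFDerivAt.comp_hasDerivAt t (hγ' t ht).1, ?_⟩
    rw [hR, spatial_timeReflectCLM, timeReflectCLM_apply_zero]
    exact (hγ' t ht).2
  · simpa [hR] using hinf
  · intro K hK hKc
    exact (hclosed K hK hKc).preimage R.continuous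

/-! ### A timelike segment leaving the image (Lemma 16 in the chart) -/

/-- Walking along the segment from a point `a` of an open set `Ω` to a point `b ∉ Ω`, there is a
first exit parameter `μ ∈ (0, 1]`: `a + μ (b - a) ∉ Ω` while `a + ν (b - a) ∈ Ω` for
`0 ≤ ν < μ` (Sbierski 2018, proof of Lemma 16, the supremum argument).
[cite: SbierskiJDG2018, §2.3, Lemma 16] -/
theorem exists_first_exit {Ω : Set E4} (hΩ : IsOpen Ω) {a b : E4} (ha : a ∈ Ω) (hb : b ∉ Ω) :
    ∃ μ ∈ Ioc (0 : ℝ) 1, a + μ • (b - a) ∉ Ω ∧ ∀ ν ∈ Ico (0 : ℝ) μ, a + ν • (b - a) ∈ Ω := by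
  set p : ℝ → E4 := fun ν ↦ a + ν • (b - a) with hp
  have hpc : Continuous p := by rw [hp]; fun_prop
  set A : Set ℝ := {μ | μ ∈ Icc (0 : ℝ) 1 ∧ ∀ ν ∈ Ico (0 : ℝ) μ, p ν ∈ Ω} with hA
  have h0A : (0 : ℝ) ∈ A := ⟨⟨le_rfl, zero_le_one⟩, fun ν hν ↦ absurd hν.2 (not_lt.mpr hν.1)⟩
  have hAne : A.Nonempty := ⟨0, h0A⟩
  have hAbdd : BddAbove A := ⟨1, fun μ hμ ↦ hμ.1.2⟩
  set μ₀ := sSup A with hμ₀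
  have hμ₀le : μ₀ ≤ 1 := csSup_le hAne fun μ hμ ↦ hμ.1.2
  have hμ₀ge : 0 ≤ μ₀ := le_csSup hAbdd h0A
  -- below the supremum the path stays in `Ω`
  have hbelow : ∀ ν ∈ Ico (0 : ℝ) μ₀, p ν ∈ Ω := by
    intro ν hν
    obtain ⟨μ, hμA, hνμ⟩ := exists_lt_of_lt_csSup hAne hν.2
    exact hμA.2 ν ⟨hν.1, hνμ⟩
  -- the supremum is positive: a neighbourhood of `0` is mapped into `Ω`
  have hpre : ∀ {ν₀ : ℝ}, p ν₀ ∈ Ω → ∃ τ > 0, ∀ ν, |ν - ν₀| < τ → p ν ∈ Ω := by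
    intro ν₀ hν₀
    have : p ⁻¹' Ω ∈ 𝓝 ν₀ := hpc.continuousAt.preimage_mem_nhds (hΩ.mem_nhds hν₀)
    obtain ⟨τ, hτ, hsub⟩ := Metric.mem_nhds_iff.mp this
    exact ⟨τ, hτ, fun ν hν ↦ hsub (by simpa [Real.dist_eq] using hν)⟩
  have hp0 : p 0 = a := by simp [hp]
  have hμ₀pos : 0 < μ₀ := by
    obtain ⟨τ, hτ, hτΩ⟩ := hpre (ν₀ := 0) (by rwa [hp0])
    have hmem : min τ 1 ∈ A := by
      refine ⟨⟨le_min hτ.le zero_le_one, min_le_right _ _⟩, fun ν hν ↦ hτΩ ν ?_⟩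
      rw [sub_zero, abs_of_nonneg hν.1]
      exact lt_of_lt_of_le hν.2 (min_le_left _ _)
    exact lt_of_lt_of_le (lt_min hτ zero_lt_one) (le_csSup hAbdd hmem)
  refine ⟨μ₀, ⟨hμ₀pos, hμ₀le⟩, fun hin ↦ ?_, hbelow⟩
  -- if the path were in `Ω` at `μ₀`, we could go further
  rcases hμ₀le.eq_or_lt with h1 | h1
  · apply hb
    have : a + μ₀ • (b - a) = b := by rw [h1]; simp
    rwa [this] at hin
  · obtain ⟨τ, hτ, hτΩ⟩ := hpre hin
    set μ' := min (μ₀ + τ / 2) 1 with hμ'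
    have hμ'gt : μ₀ < μ' := lt_min (by linarith) h1
    have hμ'A : μ' ∈ A := by
      refine ⟨⟨by linarith, min_le_right _ _⟩, fun ν hν ↦ ?_⟩
      rcases lt_or_ge ν μ₀ with h2 | h2
      · exact hbelow ν ⟨hν.1, h2⟩
      · refine hτΩ ν ?_
        rw [abs_of_nonneg (by linarith)]
        have := lt_of_lt_of_le hν.2 (min_le_left _ _)
        linarith
    exact absurd (le_csSup hAbdd hμ'A) (not_le.mpr hμ'gt)

/-- **Sbierski 2018, Lemma 16 (in the chart, via Lemma 4 and Prop. 5).** From the chart data of a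
hypothetical extension one finds a boundary point `yb ∈ V \ Ω` of the image which is the endpoint
of a `G`-timelike straight segment `yb + t u`, `t ∈ [-s₁, 0)`, lying in `Ω`.
[cite: SbierskiJDG2018, §2.3, Lemma 16] -/
theorem ChartData.exists_exit (D : ChartData) :
    ∃ yb ∈ D.V, yb ∉ D.Ω ∧ ∃ u : E4, D.G yb u u < 0 ∧
      ∃ s₁ : ℝ, 0 < s₁ ∧ ∀ t ∈ Ico (-s₁) 0, yb + t • u ∈ D.Ω := by
  obtain ⟨T, hT⟩ := D.exists_neg D.y₀ D.mem_V
  -- timelike vectors near `T` at points near `y₀` (continuity of `G`)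
  have hcont : ContinuousOn (fun p : E4 × E4 ↦ D.G p.1 p.2 p.2) (D.V ×ˢ univ) := by
    have h1 : ContinuousOn (fun p : E4 × E4 ↦ D.G p.1) (D.V ×ˢ univ) :=
      D.continuousOn_G.comp continuousOn_fst fun p hp ↦ hp.1
    exact (h1.clm_apply continuousOn_snd).clm_apply continuousOn_snd
  have hev : ∀ᶠ p : E4 × E4 in 𝓝 (D.y₀, T), p.1 ∈ D.V ∧ D.G p.1 p.2 p.2 < 0 := by
    have hca : ContinuousAt (fun p : E4 × E4 ↦ D.G p.1 p.2 p.2) (D.y₀, T) :=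
      hcont.continuousAt (prod_mem_nhds (D.isOpen_V.mem_nhds D.mem_V) univ_mem)
    exact ((D.isOpen_V.eventually_mem D.mem_V).prod_inl_nhds T).and
      (hca.eventually (gt_mem_nhds hT))
  obtain ⟨r₀, hr₀, hsub⟩ := Metric.mem_nhds_iff.mp hev
  set r := min r₀ 1 with hr
  have hr1 : r ≤ 1 := min_le_right _ _
  have hrpos : 0 < r := lt_min hr₀ zero_lt_one
  have hball : ∀ y ∈ ball D.y₀ r, ∀ X ∈ ball T r, y ∈ D.V ∧ D.G y X X < 0 := by
    intro y hy X hX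
    have : (y, X) ∈ ball (D.y₀, T) r₀ := by
      rw [← ball_prod_same]
      exact ⟨ball_subset_ball (min_le_left _ _) hy, ball_subset_ball (min_le_left _ _) hX⟩
    exact hsub this
  -- the backward segment from `y₀` of length `σ₀` in the direction `-T`
  set σ₀ : ℝ := r / (4 * (‖T‖ + 1)) with hσ₀
  have hTpos : 0 < ‖T‖ + 1 := by positivity
  have hσ₀pos : 0 < σ₀ := by rw [hσ₀]; positivity
  have hσ₀T : σ₀ * (‖T‖ + 1) = r / 4 := by rw [hσ₀]; field_simp
  -- the two cases of Lemma 16 produce a segment `[a, b]` in the ball, `a ∈ Ω`, `b ∉ Ω`,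
  -- with `G`-timelike direction `b - a`
  have key : ∃ a b : E4, a ∈ D.Ω ∧ b ∉ D.Ω ∧ a ∈ ball D.y₀ r ∧ b ∈ ball D.y₀ r ∧
      ∀ y ∈ ball D.y₀ r, D.G y (b - a) (b - a) < 0 := by
    by_cases hcase : ∃ σ ∈ Ioc (0 : ℝ) σ₀, D.y₀ - σ • T ∈ D.Ω
    · obtain ⟨σ, ⟨hσ0, hσ1⟩, hσΩ⟩ := hcase
      refine ⟨D.y₀ - σ • T, D.y₀, hσΩ, D.notMem_Ω, ?_, mem_ball_self hrpos, ?_⟩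
      · rw [mem_ball, dist_eq_norm, sub_sub_cancel_left, norm_neg, norm_smul,
          Real.norm_eq_abs, abs_of_pos hσ0]
        nlinarith [norm_nonneg T]
      · intro y hy
        have h := (hball y hy T (mem_ball_self hrpos)).2
        have e : D.y₀ - (D.y₀ - σ • T) = σ • T := by abel
        rw [e, map_smul, map_smul, FunLike.coe_smul, Pi.smul_apply, smul_eq_mul, smul_eq_mul]
        nlinarith [mul_pos hσ0 hσ0]
    · push Not at hcase
      have hbΩ : D.y₀ - σ₀ • T ∉ D.Ω := hcase σ₀ ⟨hσ₀pos, le_rfl⟩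
      obtain ⟨a, haΩ, ha⟩ := Metric.mem_closure_iff.mp D.mem_closure (min (σ₀ * r) (r / 2))
        (lt_min (mul_pos hσ₀pos hrpos) (by linarith))
      have ha1 : dist D.y₀ a < σ₀ * r := lt_of_lt_of_le ha (min_le_left _ _)
      have ha2 : dist D.y₀ a < r / 2 := lt_of_lt_of_le ha (min_le_right _ _)
      set X : E4 := T - σ₀⁻¹ • (D.y₀ - a) with hX
      have hXT : X ∈ ball T r := by
        rw [mem_ball, dist_eq_norm, hX, sub_sub_cancel_left, norm_neg, norm_smul, norm_inv,
          Real.norm_eq_abs, abs_of_pos hσ₀pos, ← dist_eq_norm]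
        rwa [inv_mul_lt_iff₀ hσ₀pos]
      have hba : D.y₀ - σ₀ • T - a = (-σ₀) • X := by
        rw [hX, neg_smul, smul_sub, smul_inv_smul₀ hσ₀pos.ne']; abel
      refine ⟨a, D.y₀ - σ₀ • T, haΩ, hbΩ, ?_, ?_, ?_⟩
      · rw [mem_ball, dist_comm]; linarith
      · rw [mem_ball, dist_eq_norm, sub_sub_cancel_left, norm_neg, norm_smul,
          Real.norm_eq_abs, abs_of_pos hσ₀pos]
        nlinarith [norm_nonneg T]
      · intro y hy
        have h := (hball y hy X hXT).2
        rw [hba, map_smul, map_smul, FunLike.coe_smul, Pi.smul_apply, smul_eq_mul, smul_eq_mul]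
        nlinarith [mul_pos hσ₀pos hσ₀pos]
  obtain ⟨a, b, haΩ, hbΩ, ha, hb, hab⟩ := key
  obtain ⟨μ, ⟨hμ0, hμ1⟩, hexit, hin⟩ := exists_first_exit D.isOpen_Ω haΩ hbΩ
  have hyb : a + μ • (b - a) ∈ ball D.y₀ r :=
    (convex_ball D.y₀ r).add_smul_sub_mem ha hb ⟨hμ0.le, hμ1⟩
  refine ⟨a + μ • (b - a), (hball _ hyb T (mem_ball_self hrpos)).1, hexit, b - a, hab _ hyb,
    μ, hμ0, fun t ht ↦ ?_⟩
  have e : a + μ • (b - a) + t • (b - a) = a + (μ + t) • (b - a) := by rw [add_smul]; abel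
  rw [e]
  exact hin (μ + t) ⟨by linarith [ht.1], by linarith [ht.2]⟩

/-! ### Normalisation of the chart data and the conclusion -/

/-- Operator-norm bound for the double pullback of a bilinear form by a linear map. [folklore] -/
theorem norm_bilinearComp_le (B : E4 →L[ℝ] E4 →L[ℝ] ℝ) (P : E4 →L[ℝ] E4) :
    ‖B.bilinearComp P P‖ ≤ ‖B‖ * ‖P‖ * ‖P‖ := by
  refine ContinuousLinearMap.opNorm_le_bound₂ _ (by positivity) fun v w ↦ ?_
  rw [ContinuousLinearMap.bilinearComp_apply]
  calc ‖B (P v) (P w)‖ ≤ ‖B‖ * ‖P v‖ * ‖P w‖ := B.le_opNorm₂ _ _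
    _ ≤ ‖B‖ * (‖P‖ * ‖v‖) * (‖P‖ * ‖w‖) := by
        gcongr <;> exact P.le_opNorm _
    _ = ‖B‖ * ‖P‖ * ‖P‖ * ‖v‖ * ‖w‖ := by ring

/-- `bilinearComp` is additive in the bilinear form. [folklore] -/
theorem bilinearComp_sub (B B' : E4 →L[ℝ] E4 →L[ℝ] ℝ) (P : E4 →L[ℝ] E4) :
    (B - B').bilinearComp P P = B.bilinearComp P P - B'.bilinearComp P P := by
  ext v w
  simp [ContinuousLinearMap.bilinearComp_apply]

/-- The coordinate map `F` of the chart data is differentiable on `W`. [folklore] -/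
theorem ChartData.hasFDerivAt_F (D : ChartData) {x : E4} (hx : x ∈ D.W) :
    HasFDerivAt D.F (fderiv ℝ D.F x) x :=
  ((D.contDiffOn.differentiableOn one_ne_zero x hx).differentiableAt
    (D.isOpen_W.mem_nhds hx)).hasFDerivAt

/-- The inverse `H` of `F` is differentiable on `Ω`, with derivative the inverse of that of `F`
(inverse function theorem, given the continuous inverse; `DF` is invertible because `F` is an
`η`-isometry). [folklore] -/
theorem ChartData.hasFDerivAt_H (D : ChartData) {y : E4} (hy : y ∈ D.Ω) :
    HasFDerivAt D.H (fderiv ℝ D.F (D.H y)).inverse y ∧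
      (fderiv ℝ D.F (D.H y)).comp (fderiv ℝ D.F (D.H y)).inverse =
        ContinuousLinearMap.id ℝ E4 := by
  have hinj := injective_of_isometry (D.isometry _ (D.H_mem y hy))
  set Eq : E4 ≃L[ℝ] E4 := (LinearEquiv.ofBijective (fderiv ℝ D.F (D.H y)).toLinearMap
    ⟨hinj, LinearMap.injective_iff_surjective.mp hinj⟩).toContinuousLinearEquiv with hEq
  have hEq' : (Eq : E4 →L[ℝ] E4) = fderiv ℝ D.F (D.H y) := by ext v; rfl
  have h1 : HasFDerivAt D.H (Eq.symm : E4 →L[ℝ] E4) y := by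
    refine HasFDerivAt.of_local_left_inverse (D.continuousOn_H.continuousAt
      (D.isOpen_Ω.mem_nhds hy)) (by rw [hEq']; exact D.hasFDerivAt_F (D.H_mem y hy)) ?_
    filter_upwards [D.isOpen_Ω.mem_nhds hy] with y' hy' using D.right_inv y' hy'
  have h2 : (fderiv ℝ D.F (D.H y)).inverse = (Eq.symm : E4 →L[ℝ] E4) := by
    rw [← hEq', ContinuousLinearMap.inverse_equiv]
  rw [h2]
  refine ⟨h1, ?_⟩
  rw [← hEq']
  ext v
  simp

/-- **Lemma 4 (near-Minkowskian chart)**: in the frame `P` at `yb` the metric components are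
`1/5`-close to `η` on a small ball, which the affine chart `z ↦ yb + P z` maps into `V`.
[cite: SbierskiJDG2018, §2.1, Lemma 4] -/
theorem ChartData.exists_ball (D : ChartData) {yb : E4} (hyb : yb ∈ D.V) (P : E4 ≃L[ℝ] E4)
    (hP : ∀ v w, D.G yb (P v) (P w) = η v w) :
    ∃ ε : ℝ, 0 < ε ∧ (∀ z ∈ ball (0 : E4) ε, yb + P z ∈ D.V) ∧
      ∀ z ∈ ball (0 : E4) ε,
        ‖(D.G (yb + P z)).bilinearComp (P : E4 →L[ℝ] E4) (P : E4 →L[ℝ] E4) - η‖ ≤ 1 / 5 := by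
  set Pc : E4 →L[ℝ] E4 := (P : E4 →L[ℝ] E4) with hPc
  have hGcont : ContinuousAt D.G yb := D.continuousOn_G.continuousAt (D.isOpen_V.mem_nhds hyb)
  set δ : ℝ := (1 / 5) / (‖Pc‖ * ‖Pc‖ + 1) with hδ
  have hδpos : 0 < δ := by rw [hδ]; positivity
  have hevG : ∀ᶠ y in 𝓝 yb, ‖D.G y - D.G yb‖ < δ := by
    have h := ((tendsto_iff_norm_sub_tendsto_zero (f := D.G) (b := D.G yb)).mp
      hGcont.tendsto).eventually (gt_mem_nhds hδpos)
    exact h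
  obtain ⟨ρ, hρ, hρG⟩ := Metric.eventually_nhds_iff_ball.mp hevG
  obtain ⟨ρ', hρ', hρ'V⟩ := Metric.isOpen_iff.mp D.isOpen_V yb hyb
  set ρ₀ := min ρ ρ' with hρ₀
  have hρ₀pos : 0 < ρ₀ := lt_min hρ hρ'
  set ε : ℝ := ρ₀ / (‖Pc‖ + 1) with hε
  have hεpos : 0 < ε := by rw [hε]; positivity
  have hA : ∀ z ∈ ball (0 : E4) ε, yb + P z ∈ ball yb ρ₀ := by
    intro z hz
    rw [mem_ball, dist_zero_right] at hz
    rw [mem_ball, dist_eq_norm, add_sub_cancel_left]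
    calc ‖P z‖ ≤ ‖Pc‖ * ‖z‖ := Pc.le_opNorm z
      _ ≤ (‖Pc‖ + 1) * ‖z‖ := by gcongr; linarith
      _ < (‖Pc‖ + 1) * ε := by gcongr
      _ = ρ₀ := by rw [hε]; field_simp
  have hG'η : (D.G yb).bilinearComp Pc Pc = η := by
    ext v w
    simp [ContinuousLinearMap.bilinearComp_apply, hPc, hP]
  refine ⟨ε, hεpos, fun z hz ↦ hρ'V (ball_subset_ball (min_le_right _ _) (hA z hz)),
    fun z hz ↦ ?_⟩
  have h1 : ‖D.G (yb + P z) - D.G yb‖ < δ :=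
    hρG _ (ball_subset_ball (min_le_left _ _) (hA z hz))
  rw [← hG'η, ← bilinearComp_sub]
  calc ‖(D.G (yb + P z) - D.G yb).bilinearComp Pc Pc‖
      ≤ ‖D.G (yb + P z) - D.G yb‖ * ‖Pc‖ * ‖Pc‖ := norm_bilinearComp_le _ _
    _ ≤ δ * ‖Pc‖ * ‖Pc‖ := by gcongr
    _ = (1 / 5) * (‖Pc‖ * ‖Pc‖ / (‖Pc‖ * ‖Pc‖ + 1)) := by rw [hδ]; ring
    _ ≤ (1 / 5) * 1 := by
        gcongr
        rw [div_le_one (by positivity)]; linarith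
    _ = 1 / 5 := by norm_num

section Normalised

variable (D : ChartData) (yb : E4) (P : E4 ≃L[ℝ] E4)

/-- The coordinate map in the recentred frame: `x ↦ P⁻¹ (F x - yb)`.
[cite: SbierskiJDG2018, §2.1, Lemma 4] -/
def ChartData.normF (x : E4) : E4 := P.symm (D.F x - yb)

/-- Its derivative. [cite: SbierskiJDG2018, §2.1, Lemma 4] -/
def ChartData.normF' (x : E4) : E4 →L[ℝ] E4 := (P.symm : E4 →L[ℝ] E4).comp (fderiv ℝ D.F x)

/-- The metric components in the recentred frame. [cite: SbierskiJDG2018, §2.1, Lemma 4] -/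
def ChartData.normG (z : E4) : E4 →L[ℝ] E4 →L[ℝ] ℝ :=
  (D.G (yb + P z)).bilinearComp (P : E4 →L[ℝ] E4) (P : E4 →L[ℝ] E4)

variable {D yb P}

/-- Derivative of the recentred coordinate map. [folklore] -/
theorem ChartData.hasFDerivAt_normF {x : E4} (hx : x ∈ D.W) :
    HasFDerivAt (D.normF yb P) (D.normF' P x) x :=
  (P.symm : E4 →L[ℝ] E4).hasFDerivAt.comp x ((D.hasFDerivAt_F hx).sub_const yb)

/-- The recentred coordinate map is an isometry from `η` to the recentred metric components (the
isometry condition is frame independent). [folklore] -/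
theorem ChartData.normG_normF {x : E4} (hx : x ∈ D.W) (v w : E4) :
    D.normG yb P (D.normF yb P x) (D.normF' P x v) (D.normF' P x w) = η v w := by
  simp only [ChartData.normG, ChartData.normF, ChartData.normF',
    ContinuousLinearMap.bilinearComp_apply, ContinuousLinearMap.coe_comp, Function.comp_apply,
    ContinuousLinearEquiv.coe_coe, ContinuousLinearEquiv.apply_symm_apply, add_sub_cancel]
  exact D.isometry x hx v w

/-- Closedness of `W ∩ F⁻¹(K)` for compact `K` in the recentred chart ball. [folklore] -/
theorem ChartData.isClosed_inter_preimage_normF {ε : ℝ}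
    (hV : ∀ z ∈ ball (0 : E4) ε, yb + P z ∈ D.V) {K : Set E4} (hK : K ⊆ ball (0 : E4) ε)
    (hKc : IsCompact K) : IsClosed (D.W ∩ D.normF yb P ⁻¹' K) := by
  have hK' : IsCompact ((fun z ↦ yb + P z) '' K) := hKc.image (by fun_prop)
  have heq : D.W ∩ D.normF yb P ⁻¹' K = D.W ∩ D.F ⁻¹' ((fun z ↦ yb + P z) '' K) := by
    ext x
    simp only [mem_inter_iff, mem_preimage, mem_image, ChartData.normF]
    constructor
    · rintro ⟨hx, hK⟩
      exact ⟨hx, _, hK, by simp⟩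
    · rintro ⟨hx, z, hz, hzx⟩
      refine ⟨hx, ?_⟩
      rw [← hzx, add_sub_cancel_left, ContinuousLinearEquiv.symm_apply_apply]
      exact hz
  rw [heq]
  exact D.isClosed_preimage _ (fun y ⟨z, hz, hzy⟩ ↦ hzy ▸ hV z (hK hz)) hK'

end Normalised

/-- **Sbierski 2018, Thm. 17 (Minkowski space is `C⁰`-inextendible), analytic content**: the
chart data of a hypothetical `C⁰`-extension of Minkowski space are contradictory. Lemma 16 gives
a timelike segment of the chart reaching a boundary point `ỹ` of the image from inside; the
Sylvester frame at `ỹ` with this segment as time axis, recentred at `ỹ` and shrunk to a ball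
on which `‖G - η‖ ≤ 1/5` (Lemma 4), turns the data into the normalised data of `core_false`,
the pulled-back segment `γ = H(ỹ + t u)` being an unbounded (properness of `ι`) timelike curve
of Minkowski space, future directed after a time reversal if necessary (`core_false_past`).
[cite: SbierskiJDG2018, §3, Thm. 17] -/
theorem ChartData.false (D : ChartData) : False := by
  obtain ⟨yb, hybV, hybΩ, u, hu, s₁, hs₁, hseg⟩ := D.exists_exit
  obtain ⟨P, c, hc, hP0, hPiso⟩ :=
    exists_frame (D.symm_G yb hybV) (D.pos_of_orthogonal yb hybV) hu
  obtain ⟨ε, hεpos, hAV, hG'near⟩ := D.exists_ball hybV P hPiso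
  -- the pulled-back segment
  set s₀ : ℝ := min (s₁ / c) (ε / 4) with hs₀
  have hs₀pos : 0 < s₀ := lt_min (div_pos hs₁ hc) (by linarith)
  have hs₀ε : 3 * s₀ < ε := by
    have := min_le_right (s₁ / c) (ε / 4); linarith
  have hct : ∀ t ∈ Ico (-s₀) 0, c * t ∈ Ico (-s₁) 0 := by
    intro t ht
    constructor
    · have h1 : s₀ ≤ s₁ / c := min_le_left _ _
      have h2 : c * s₀ ≤ s₁ := by rwa [← le_div_iff₀' hc]
      nlinarith [ht.1]
    · nlinarith [ht.2]
  set q : ℝ → E4 := fun t ↦ yb + (c * t) • u with hq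
  have hqΩ : ∀ t ∈ Ico (-s₀) 0, q t ∈ D.Ω := fun t ht ↦ hseg (c * t) (hct t ht)
  have hqd : ∀ t, HasDerivAt q (c • u) t := by
    intro t
    have := (((hasDerivAt_id t).const_mul c).smul_const u).const_add yb
    simpa [hq] using this
  have hPt : ∀ t : ℝ, P (t • E4.basisVector 0) = (c * t) • u := by
    intro t; rw [map_smul, hP0, smul_smul, mul_comm]
  set γ : ℝ → E4 := fun t ↦ D.H (q t) with hγ
  set γ' : ℝ → E4 := fun t ↦ (fderiv ℝ D.F (γ t)).inverse (c • u) with hγ'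
  have hγW : ∀ t ∈ Ico (-s₀) 0, γ t ∈ D.W := fun t ht ↦ D.H_mem _ (hqΩ t ht)
  have hγF : ∀ t ∈ Ico (-s₀) 0, D.normF yb P (γ t) = t • E4.basisVector 0 := by
    intro t ht
    simp only [ChartData.normF, hγ]
    rw [D.right_inv _ (hqΩ t ht), hq]
    simp only [add_sub_cancel_left]
    rw [← hPt, ContinuousLinearEquiv.symm_apply_apply]
  have hγc : ContinuousOn γ (Ico (-s₀) 0) :=
    D.continuousOn_H.comp (by rw [hq]; fun_prop) hqΩ
  have hγd : ∀ t ∈ Ioo (-s₀) 0, HasDerivAt γ (γ' t) t ∧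
      fderiv ℝ D.F (γ t) (γ' t) = c • u := by
    intro t ht
    obtain ⟨hH, hinv⟩ := D.hasFDerivAt_H (hqΩ t ⟨ht.1.le, ht.2⟩)
    refine ⟨hH.comp_hasDerivAt t (hqd t), ?_⟩
    have := congrArg (fun L : E4 →L[ℝ] E4 ↦ L (c • u)) hinv
    rw [ContinuousLinearMap.comp_apply, ContinuousLinearMap.id_apply] at this
    exact this
  -- the velocities are `η`-timelike
  have hγ'tl : ∀ t ∈ Ioo (-s₀) 0, η (γ' t) (γ' t) < 0 := by
    intro t ht
    have hmemI : t ∈ Ico (-s₀) 0 := ⟨ht.1.le, ht.2⟩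
    have h1 := D.normG_normF (yb := yb) (P := P) (hγW t hmemI) (γ' t) (γ' t)
    have h2 : D.normF' P (γ t) (γ' t) = E4.basisVector 0 := by
      simp only [ChartData.normF', ContinuousLinearMap.coe_comp, Function.comp_apply,
        ContinuousLinearEquiv.coe_coe]
      rw [(hγd t ht).2, ← hP0, ContinuousLinearEquiv.symm_apply_apply]
    rw [h2, hγF t hmemI] at h1
    rw [← h1]
    refine self_basisVector_neg (hG'near _ ?_)
    rw [mem_ball, dist_zero_right, norm_smul_basisVector, abs_of_neg ht.2]
    have := min_le_right (s₁ / c) (ε / 4)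
    linarith [ht.1]
  -- unboundedness of `γ` from properness of `F` at `ỹ ∉ Ω`
  have hinf : Tendsto (fun t ↦ ‖γ t‖) (𝓝[<] 0) atTop := by
    rw [Filter.tendsto_atTop]
    intro R
    obtain ⟨N, hN, hR⟩ := D.proper yb hybV hybΩ R
    have hq0 : Tendsto q (𝓝[<] 0) (𝓝 yb) := by
      have h := (hqd 0).continuousAt.tendsto
      simp only [hq, mul_zero, zero_smul, add_zero] at h
      exact tendsto_nhdsWithin_of_tendsto_nhds h
    have h1 : ∀ᶠ t in 𝓝[<] (0 : ℝ), q t ∈ N := hq0 hN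
    have h2 : ∀ᶠ t in 𝓝[<] (0 : ℝ), t ∈ Ico (-s₀) 0 := by
      filter_upwards [Ioo_mem_nhdsLT (neg_lt_zero.mpr hs₀pos)] with t ht using ⟨ht.1.le, ht.2⟩
    filter_upwards [h1, h2] with t ht1 ht2
    have := hR (γ t) (hγW t ht2) (by rwa [hγ, D.right_inv _ (hqΩ t ht2)])
    exact this.le
  -- the time component of the velocity has constant sign (Darboux): future or past directed
  have hderiv0 : ∀ t ∈ Ioo (-s₀) 0, HasDerivAt (fun t ↦ γ t 0) (γ' t 0) t := by
    intro t ht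
    have := ((EuclideanSpace.proj (0 : Fin 4) : E4 →L[ℝ] ℝ).hasFDerivAt.comp_hasDerivAt t
      (hγd t ht).1)
    simpa [Function.comp_def] using this
  have hne : ∀ t ∈ Ioo (-s₀) 0, γ' t 0 ≠ 0 := by
    intro t ht h0
    have := hγ'tl t ht
    rw [bilin_self_eq, h0] at this
    nlinarith [norm_nonneg (sp (γ' t))]
  have hsp : ∀ t ∈ Ioo (-s₀) 0, ‖sp (γ' t)‖ < |γ' t 0| := by
    intro t ht
    have := hγ'tl t ht
    rw [bilin_self_eq] at this
    refine abs_lt_of_sq_lt_sq' ?_ (abs_nonneg _) |>.2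
    rw [sq_abs]; linarith
  rcases hasDerivWithinAt_forall_lt_or_forall_gt_of_forall_ne (convex_Ioo (-s₀) 0)
    (fun t ht ↦ (hderiv0 t ht).hasDerivWithinAt) hne with hpast | hfut
  · refine core_false_past D.isOpen_W (fun x hx ↦ D.hasFDerivAt_normF (yb := yb) (P := P) hx)
      (fun x hx ↦ D.normG_normF hx) hG'near hs₀pos hs₀ε hγW hγF hγc
      (fun t ht ↦ ⟨(hγd t ht).1, ?_⟩) hinf
      (fun K hK hKc ↦ D.isClosed_inter_preimage_normF hAV hK hKc)
    rw [← abs_of_neg (hpast t ht)]; exact hsp t ht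
  · refine core_false D.isOpen_W (fun x hx ↦ D.hasFDerivAt_normF (yb := yb) (P := P) hx)
      (fun x hx ↦ D.normG_normF hx) hG'near hs₀pos hs₀ε hγW hγF hγc
      (fun t ht ↦ ⟨(hγd t ht).1, ?_⟩) hinf
      (fun K hK hKc ↦ D.isClosed_inter_preimage_normF hAV hK hKc)
    rw [← abs_of_pos (hfut t ht)]; exact hsp t ht

end C0Extension

/-- **Sbierski's theorem** (J. Differential Geom. 108 (2018), Thm. 17 with `d = 3`; arXiv:1507.00601,
§3): Minkowski spacetime `(ℝ⁴, η)` is `C⁰`-inextendible — there is no smooth isometric open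
embedding of it onto a proper subset of a connected Lorentzian `4`-manifold with continuous metric.
Discharges the named fact `minkowski_isC0Inextendible`.
[cite: SbierskiJDG2018, §3, Theorem 17 (Minkowski spacetime is C⁰-inextendible); arXiv:1507.00601v2, Lemma 4, Prop. 5, Lemma 16] -/
theorem minkowski_isC0Inextendible_holds : minkowski_isC0Inextendible := by
  rintro ⟨𝓜', ι, hι⟩
  obtain ⟨p, hp, hp'⟩ := C0Extension.exists_mem_closure_notMem hι
  exact (C0Extension.chartDataOf ι hι p hp hp').false

end Literature.Geometry.Lorentzian

end
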